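import Summits.FinalStateConjecture.FinalStateConjecture.Theses.PhaseMixingCapture
import Summits.FinalStateConjecture.FinalStateConjecture.Theorems.PhaseMixingCaptureCaptureSufficesReduction
import Summits.FinalStateConjecture.FinalStateConjecture.Theorems.PhaseMixingCaptureNearExtremalKappaCaptureBackgroundUniform
import Summits.FinalStateConjecture.FinalStateConjecture.Theorems.BulkKerrCaptureC2.Negative.BlockForm
import Summits.FinalStateConjecture.FinalStateConjecture.Theorems.BulkKerrCaptureC2.Negative.LoadBearing
import Summits.FinalStateConjecture.FinalStateConjecture.Theorems.PhaseMixingCaptureBulkKerrCaptureC2UniformKillingShells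
import Summits.FinalStateConjecture.FinalStateConjecture.Theorems.PhaseMixingCaptureBulkKerrCaptureC2SlabPairContDiff
import Summits.FinalStateConjecture.FinalStateConjecture.Theorems.PhaseMixingCaptureBulkKerrCaptureC2TeukolskyOpDilate
import Summits.FinalStateConjecture.FinalStateConjecture.Theorems.PhaseMixingCaptureBulkKerrCaptureC2SlabPairDilate
import Summits.FinalStateConjecture.FinalStateConjecture.Theorems.PhaseMixingCaptureBulkKerrCaptureC2TeukolskyEnergyDilate
import Summits.FinalStateConjecture.FinalStateConjecture.Theorems.PhaseMixingCaptureBulkKerrCaptureC2SlabLawDilate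
import Summits.FinalStateConjecture.FinalStateConjecture.Theorems.PhaseMixingCaptureBulkKerrCaptureC2CaptureAscent
import Literature.Geometry.Lorentzian.HorizonPenetratingTeukolsky
import Literature.Geometry.Lorentzian.KerrSchildHomogeneity
import Literature.Geometry.Lorentzian.KerrTimelikeSpan
import HarnessLib

/-!
# Line `bounded-kappa-closing-box` (MERGED with `killing-shell-packets`, triage r2 ×3) for crux
# `BulkKerrCaptureC2` (stmt-FinalStateConjecture-14985) — skeleton v5 (lead c7, 2026-08-16: `P` reshaped to its ∃-form, ascent LANDED)

## Skeleton v5 (lead c7): the nonlinear stub `P` is RESHAPED to its existential (printed) form `P∃`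
The landed support file `Theorems/PhaseMixingCaptureBulkKerrCaptureC2CaptureAscent.lean` (p125190, ACCEPTED 853f80fb2450, ~360
lines, fact-free; registered sub-goals `stub_captureAt_of_forall_exists`, `stub_captureC2At_of_forall_exists`) proves that the
capture conclusion ASCENDS along embeddings of developments: far-origin sojourn completeness of `𝓘⁺`
(`hasCompleteFutureNullInfinityFrom_of_embedsInto`, via the landed lift `exists_isNormalisedNullRayFrom_lift`) and `Cᵏ`
Kerr-convergence of a region (`convergesToKerr_of_embedsInto`) pass from ONE vacuum Cauchy development to every development it
embeds into, hence (maximality = every development embeds) to every MAXIMAL one. Consequently the block `CaptureAt s δ 2 M _ ε C a`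
— the conclusion of `P` — follows from "every datum in the ball has ONE good vacuum Cauchy development" (far-complete, a region
`C²`-converging to a sub-extremal `g_{M',a'}`, `|M' − M| + |a' − a| ≤ C√dist`). The registered nonlinear stub is now
`P∃ = stub_packetClosingBoxExists`: verbatim `P` with its conclusion replaced by that existential form — exactly the shape in
which bootstrap / Nash–Moser stability theorems are PRINTED (Klainerman–Szeftel 2023 Thm 1.2.1: a development of the data with
complete `𝓘⁺` converging to `g_{M_f,a_f}`; Hintz arXiv:2606.28253 Thm 13.1: a solution on `Ω = {𝔱 ≥ 0, r ≥ m₀}`), with no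
reasoning about abstract maximal developments left to its prover. `P ⇐ P∃` is the theorem `packetClosingBoxC2_of_exists` (§2);
`P∃ ⇐ P` holds modulo existence of maximal developments (Choquet-Bruhat–Geroch), `packetClosingBoxExists_of_packetClosingBoxC2`;
so the normal form is unchanged in substance: mod `L₁` (and CBG for the converse) `P∃ ⇔ P ⇔ StrongCaptureTwo ≥ crux`.
Composition: `BulkKerrCaptureC2_of : L₁ → P∃ → crux` (§3). Registered open stubs after v5: {`stub_unitMassSlabLaw` (`L₁`),
`stub_packetClosingBoxExists` (`P∃`)}; `stub_packetClosingBoxC2` survives as a DERIVED theorem (from `P∃`), for the record.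

## Skeleton v4 (lead c6, wave 1 integrated): the five dilation stubs are LANDED and discharged inside the composition
`D0 = stub_slabPair_contDiffAt` p120331 (Theorems/PhaseMixingCaptureBulkKerrCaptureC2SlabPairContDiff.lean, 196 lines),
`D1 = stub_teukolskyOpOn_dilate` p120876 (…TeukolskyOpDilate.lean, 296 lines), `D2 = stub_slabPair_dilate` p121404
(…SlabPairDilate.lean, 321 lines), `D3 = stub_teukolskyEnergyOn_dilate` p122447 (…TeukolskyEnergyDilate.lean, 395 lines),
`D4 = stub_slabLaw_dilate` p122941 (…SlabLawDilate.lean, 268 lines) — all ACCEPTED, axioms {propext, Classical.choice,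
Quot.sound}, fact-free. Hence the dilation covariance `SlabLawDilate` and `L ⇐ L₁` (`bulkTeukolskySlabLaw_of_unitMass`) are
THEOREMS (also landed as a tree helper: `Theorems.BulkKerrCaptureC2.SlabLawScaling.{slabLaw_dilate, slabLaw_anti_radius,
slabLaw_mono_regularity, stub_bulkSlabLaw_of_unitMassSlabLaw}`, p123415, Theorems/PhaseMixingCaptureBulkKerrCaptureC2SlabLawScaling.lean), and the composition is `BulkKerrCaptureC2_of : L₁ → P → crux` with exactly TWO registered stubs open:
`stub_unitMassSlabLaw` (`L₁`, the unprinted a-uniform inhomogeneous `s = ±2` slab law at unit mass) and `stub_packetClosingBoxC2`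
(`P`, the open nonlinear theorem, `⇔ StrongCaptureTwo` mod `L₁`).

## Skeleton v3 (lead c6): the linear stub `L` is RESHAPED into its unprinted core plus provable glue

`L = stub_bulkTeukolskySlabLaw` (lead a1: stub-blocked on NEW facts F1/F2 + provable glue F3) is no longer a
registered stub. It is now a THEOREM of this file (`bulkTeukolskySlabLaw_of_unitMass`, §1b) from
* `L₁ = stub_unitMassSlabLaw` — the a-uniform inhomogeneous `s = ±2` slab law AT UNIT MASS
  (`Kerr.TeukolskySlabLawOn 1 a 1 k w R C` for all `|a| ≤ a₁`): exactly a1's unprinted clause F2, with the mass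
  parameter scaled out — the irreducible linear debt of the line (per spin in print: SR–TdC arXiv:2302.08916
  Thm A homogeneous, Ma–Szeftel arXiv:2603.23437 Thm 1.2 + Rem 1.3 inhomogeneous on exact Kerr; a-UNIFORMITY of
  the constant on `|a| ≤ a₁ < 1` unprinted for `s = ±2`, printed for the scalar analogue DHRT arXiv:2410.03639
  Rem 5.0.3);
* four PROVABLE dilation-covariance stubs (a1's F3, cut along the tree's API; the Kerr family is homothetic,
  `g_{λM,λa}(λx) = g_{M,a}(x)` — `Kerr.bilin_dilate`, `Kerr.mem_region_dilate_iff` of `KerrSchildHomogeneity.lean`):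
  `D0 = stub_slabPair_contDiffAt` (fields of a slab pair are `C^∞` off the axis and off `{Δ = 0}` — the
  extension `T` of `α̃ m_s ⊗ m_s` is smooth and the frame/rescaling factors are smooth and non-vanishing there),
  `D1 = stub_teukolskyOpOn_dilate` (`𝔗_{M,a,r₀}[α ∘ D_λ](x) = 𝔗_{λM,λa,λr₀}[α](λx)`: the operator is
  homogeneous of degree `0`; `Kerr.dalembertian_eq_waveOperator` + `KerrSchild.waveOperator_comp_smul` +
  `scalarH_dilate` / `nullVector_dilate` / `radius_smul`), `D2 = stub_slabPair_dilate` (slab pairs pull back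
  along `D_λ` to slab pairs on the slab `[τ₀/λ, τ₁/λ]`, given D0 and D1), `D3 = stub_teukolskyEnergyOn_dilate`
  (the weighted energies of `α` and `α ∘ D_λ` are comparable with constants uniform for `λ` in a compact range:
  `iteratedFDeriv` scales by `λ^{-j}`, the frame by `λ`, the rescaling by `λ^{2s - 2 max(s,0)}`, Lebesgue measure
  on `E3` by `λ³`, the weight `(1 + ‖y‖)^p` by at most `max(λ, λ⁻¹)^{|p|}`), `D4 = stub_slabLaw_dilate` (the law
  transports: `TeukolskySlabLawOn M a r₀ k w R Λ → TeukolskySlabLawOn (λM) (λa) (λr₀) k w (λR) (KΛ)`, given D2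
  and D3);
* and the radius antitonicity of the law (`slabLaw_anti_radius`, proved here).
Composition: `L ⇐ L₁ ∧ D4(D2(D1, D0), D3)` (`bulkTeukolskySlabLaw_of_unitMass`: dilate from mass `1` to
`M ∈ [M₀/2, 2M₀]` at radius `R₁ = 2|R|/M₀`, then shrink the ball), so that
`BulkKerrCaptureC2_of : L₁ → D0 → D1 → D2 → D3 → D4 → P → crux` (§3, sorry-free). Registered stubs after v3:
{`stub_unitMassSlabLaw`, `stub_slabPair_contDiffAt`, `stub_teukolskyOpOn_dilate`, `stub_slabPair_dilate`,
`stub_teukolskyEnergyOn_dilate`, `stub_slabLaw_dilate`, `stub_packetClosingBoxC2`} (7 = stubs_max). The line's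
OPEN content after the D-stubs land is exactly {`L₁` (unprinted linear uniformity at unit mass),
`P` (open nonlinear theorem, `⇔ StrongCaptureTwo` mod `L`)}.

Route `PhaseMixingCapture`, rank-4 crux
`Summit.FinalStateConjecture.FinalStateConjecture.Theses.PhaseMixingCapture.BulkKerrCaptureC2`: for every
`a₁ < 1` one `(s, δ)` and, per mass `M > 0` and tolerance `η > 0`, one `ε > 0` serve every spin
`|a| ≤ a₁M`: b-conormal vacuum data `ε`-close (in `H^s_δ`) to `Kerr.data M a M` on the Kerr–Schild leaf
`{t* = 0, r > M}` have all maximal developments far-complete (sojourn form), a region converging in `C²` to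
a sub-extremal Kerr `g_{M',a'}`, `|M' − M| + |a' − a| ≤ η`.
Planner: `planner-cruxplan-stmt-FinalStateConjecture-14985-bounded-kappa-closin-0`; cards
`Cruxes/BulkKerrCaptureC2/Ideas/bounded-kappa-closing-box.md` + `…/killing-shell-packets.md` (both ideator 5,
round 2, one Sketch `Cruxes/BulkKerrCaptureC2/SketchIdeator5.lean`); line card `Lines/bounded-kappa-closing-box.md`.

## Why one merged line (triage round 2, files `TRIAGE-r2-{1,2,3}.md`)

All three triagers: `bounded-kappa-closing-box` as a SEPARATE line is redundant — its Lean (linear stub `L`,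
`box_threshold`, the composition) IS the core of `killing-shell-packets`, and its nonlinear stub
`T = BulkClosingBoxC2` is `killing-shell-packets`' `P = PacketClosingBoxC2` with the shell hypotheses deleted
and no mechanism named ("merge bounded-kappa-closing-box ≈ killing-shell-packets; keep its Lean as the packets
line's stub L + composition", r2-1 l.16, r2-3 l.81). Panel arithmetic (r2-3 l.90): closing-box fail/fail/FAIL,
packets pass/fail/PASS. This file is therefore the MERGED line in the shape r2-3 prescribes ("register exactly
3 stubs + 1 optional: shells, [trapped radii], L, P; write `P ⇔ StrongCaptureTwo (mod L, S)` into the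
skeleton", sharpen (1)–(2)), registered under the dispatched slug. If a `killing-shell-packets` plan seat runs,
it should adopt or extend THIS file, not fork it.

## The line: the (1, 2)-germ cut along the linear / nonlinear seam of DHRT, at bounded surface gravity

`BulkKerrCaptureC2_of : S → L → P → BulkKerrCaptureC2` (§3; no `sorry` of its own) with

* `stub_uniformKillingShells` = `S` (size M, fact-free, PROVABLE NOW — fan out): for `a₁ < 1`, `c₁ > 0`, `R`
  there are a shell half-width `d > 0` and a margin `μ > 0`, independent of `(M, a)`, such that on every shell
  `{|r_a(x) − r₀| ≤ dM}`, `r₀ ∈ [r₊ + c₁M, RM]`, the CONSTANT Killing field `T + ω(r₀)Φ`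
  (`ω = Kerr.drsrAngularVelocity`) satisfies `g(V, V) ≤ −μ`, for every `M > 0`, `|a| ≤ a₁M`. Centre case
  `d = 0` = DRSR arXiv:1402.7034 Lemma 4.7.1, PROVED in the tree (`Kerr.bilin_drsrVector_neg`;
  `shellCentre_timelike` below); thickening = compactness at `M = 1` + exact scaling. Numerically scanned by
  the ideator and independently by r2-1 / r2-3 (sup over shells `< 0` for `d = c₁/4` at every tested
  `(a₁, c₁)`; margins `≍ κ²`, widths `≍ κ` — a BOUNDED-κ lemma, false at `a₁ = 1`). The geometric input
  "an r-interval sufficiently small to admit a timelike Killing field `∂_{t*} + α_n∂_{φ*}`" of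
  Dafermos–Holzegel–Rodnianski–Taylor arXiv:2410.03639 (p. 4 l.23; §3.4).
* `stub_bulkTeukolskySlabLaw` = `L` (XL, LINEAR, exact Kerr; printed per spin, shared with the sibling lines of
  ranks 2/3 at spin ±2): for `a₁ < 1` ONE regularity `(k, w)` and, per `(M₀ > 0, R)`, ONE constant `C ≥ 1`
  give the DHRT (1.3)-format slab law `Kerr.TeukolskySlabLawOn M a M k w R C` (sourced spin-±2 pairs on the
  horizon-penetrating chart `{r > M}`, boundedness + ILED in one restartable inequality) for every
  `M ∈ [M₀/2, 2M₀]`, `|a| ≤ a₁M`. Per spin: Shlapentokh-Rothman–Teixeira da Costa arXiv:2007.07211 +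
  arXiv:2302.08916 Thm A (homogeneous); INHOMOGENEOUS on exact Kerr: Ma–Szeftel arXiv:2603.23437 Thm 1.2
  restricted to Kerr (Rem 1.3 p. 7: "[SR–TdC] are proved for the homogenous case … Theorem 1.2 restricted to
  subextremal Kerr holds in the general inhomogeneous case"; regularity `(k₊₂, k₋₂) = (11, 14)`). The ONE
  unprinted clause is uniformity of `C` on the compact spin set `|a| ≤ a₁M` (printed for the scalar analogue:
  arXiv:2410.03639 Rem 5.0.3 p. 58). No rate in `1 − |a|/M` is asked (that is rank 3 / rank 2's `C⁺`).
* `stub_packetClosingBoxC2` = `P` (XL, OPEN, HARDEST — the line's nonlinear debt): for every linear regularity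
  `(k, w)` and `a₁ < 1` there are `(s, δ)` and, per `M > 0`, `(R, n, c₁ > 0)` with: for all shell data
  `(d, μ) > 0` and constants `Λ, B ≥ 1` ONE basin `ε > 0` and ONE Lipschitz constant `C` serve every
  `|a| ≤ a₁M` — granted the shells `ShellsAt M a c₁ R d μ`, the slab law with constant `Λ` on the parameter
  box `|M' − M| + |a' − a| ≤ Mχ/8` and the background bound `B`, `CaptureAt s δ 2 M _ ε C a` (finite-order
  `H^s_δ` ball, far-complete 𝓘⁺, a region converging in `C²` to a sub-extremal Kerr, modulus `C√dist`).
  MECHANISM (the reason this line survived triage): the `(t*, φ*)`-wave-packet method of arXiv:2410.03639 —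
  finitely many Killing-frequency packets, superradiant ones untrapped, each non-superradiant one trapped in
  ONE shell carrying a timelike Killing field (stub `S`), top order closed by physical-space currents on the
  dynamical metric, the exact-Kerr linear law (stub `L`) entering only as the inhomogeneous black box; its
  SCALAR model is a theorem in print with exactly the crux's quantifier shape (loc. cit. Thm 5.1 + Rem 5.0.3
  p. 58: "ε_global and C can be chosen uniformly for all a ∈ [−a₀, a₀] for any 0 < a₀ < M … no control over
  C(a₀, M) as a₀ → M, even for the linear wave equation"), and its Einstein-vacuum instance is the method's
  authors' announced expectation (p. 5 ll.17–27: "the analogue of the black box estimate 1. for the Teukolsky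
  equation on Kerr has been shown … in [SR–TdC] … It is reasonable thus to expect that the characteristic
  'quasilinear' difficulties of the stability problem for the Einstein equations can indeed be entirely
  addressed by combining our method with the results of [SR–TdC]. This will appear elsewhere."). UNPRINTED at
  every `a` (DHRT21 arXiv:2104.08222 is the `a = 0` Einstein-vacuum architecture). Internal rows (the prover's
  plan, not stubs): (P.i) a₁-uniform trapped radii `r_trap ∈ [r₊ + c₁(a₁)M, 7M)` (per spin PROVED:
  `Kerr.exists_sepPotential_trapping_structure`, DRSR Lemma 8.6.1 — its `d` is already `a`-free); (P.ii) the
  packet covering and the `n`-dependent top-order currents for the almost-decoupled Teukolsky / gRW system of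
  the dynamical metric; (P.iii) the Einstein-specific residual the scalar model does not see — top-order
  coupling to the transport / elliptic / gauge part and modulation to `(M', a')` inside the box; (P.iv)
  far-completeness and the `C√dist` modulus from the bootstrap's final-parameter tracking.

NORMAL FORM OF THE DEBT (r2-2's certificate, re-derived and kernel-checked in §2): modulo the TRUE inputs
`S`, `L` and the landed `BackgroundUniform` (p77983), `P ⇔ T ⇔ StrongCaptureTwo` := the pre-ruling strong-form
bulk capture with the order pinned to `2` (`∀ a₁ < 1 ∃ (s, δ) ∀ M > 0 ∃ ε > 0 ∃ C ∀ |a| ≤ a₁M,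
CaptureAt s δ 2 M _ ε C a`) — STRONGER than the crux (bare finite-order ball, Lipschitz modulus; the crux follows
by the landed `bulkKerrCaptureC2_of_captureAt_two`) and implying the route's support item `BulkKerrCapture`
(witness `k := 2`, `bulkKerrCapture_of_strong`). So whoever closes `P` closes rank 4 AND the pre-ruling
strong form on which three pre-ruling lines died as PORTS (`Cruxes/BulkKerrCapture/Lines/*-dead.md`: no source
prints it); this line proposes to PROVE it by a named method at bounded κ — it is not weaker than those lines,
and says so.

DISPROOF USED (`Cruxes/BulkKerrCaptureC2/Disproof.lean`, cdisprove c1, NO KILL; no `_false_without_<H>` theorem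
exists for this crux, so no "uses H at stub_k" line is owed; the load-bearing hypotheses of §5 are honoured
explicitly): §2 `bulkKerrCaptureC2_iff_nonneg` — the `a₁ < 0` branch is vacuous (`Negative.no_spin_of_neg`,
first case split of `strongCaptureTwo_of_bulkClosingBox`); §5 `strengthenings_fail_of_rigidity` + the
predecessor's `bulkCaptureFamily_false_without_spinGap` / `_without_posMass` — `a₁ < 1` enters at
`a₂ = √((2 + a₁²)/3) < 1` (threshold at which `L` is consumed on the boxes, `box_threshold`) and in `S`
(`μ(a₁) > 0`: at `a₁ = 1` the shells die, `μ ≍ κ²`); `0 < M` enters through `|a| ≤ a₁M < M` (sub-extremality on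
the box) and the scaling of `S`; §3 `captureC2At_atKerrData` — consistent (the Lipschitz modulus pins the
centre); §7 `stub1_iff_claim` — the dead lines' single stub (the Hintz claim BY NAME) occurs nowhere in this
file; `-- Targets`: none posted against `S`, `L`, `P`. Landed Negative files imported and checked against:
`Negative/BlockForm` (p99148), `Negative/LoadBearing` (p100887): the line proves the crux AS TYPED
(`T = Iio 1`, `P = (0 < ·)`), no closed-range or massless member is claimed.
-/

-- the doubled `FinalStateConjecture.FinalStateConjecture` path component trips dupNamespace
set_option linter.dupNamespace false

noncomputable section

open Set Filter
open scoped Manifold ENNReal ContDiff Topology Pointwise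

namespace Summit.FinalStateConjecture.FinalStateConjecture.Cruxes.BulkKerrCaptureC2.BoundedKappaClosingBox

open Literature.Geometry.Lorentzian
open Summit.FinalStateConjecture.FinalStateConjecture.Theses.PhaseMixingCapture
  (BulkKerrCaptureC2 BulkKerrCapture)
open Summit.FinalStateConjecture.FinalStateConjecture.Theorems.BulkKerrCapture.Negative
  (CaptureAt bulkKerrCapture_iff no_spin_of_neg)
open Summit.FinalStateConjecture.FinalStateConjecture.Theorems.PhaseMixingCaptureCaptureSuffices
  (bulkKerrCaptureC2_of_captureAt_two)

/-! ## §0 The statements of the line (named `Prop`s) -/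

/-- **`L` — bounded-κ Teukolsky slab law** (statement of STUB `stub_bulkTeukolskySlabLaw`). For every
threshold `a₁ < 1` there is ONE regularity `(k, w)` such that for every mass scale `M₀ > 0` and radius `R`
there is `C = C(a₁, M₀, R) ≥ 1` giving the DHRT (1.3)-format slab law `Kerr.TeukolskySlabLawOn M a M k w R C`
(sourced spin-±2 pairs on the horizon-penetrating chart `{r > M}`) for every `M ∈ [M₀/2, 2M₀]` and every
`|a| ≤ a₁M`. Per spin in print (SR–TdC arXiv:2302.08916 Thm A homogeneous; Ma–Szeftel arXiv:2603.23437
Thm 1.2|Kerr inhomogeneous, Rem 1.3); uniformity on the compact spin set is the one unprinted clause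
(scalar analogue: arXiv:2410.03639 Rem 5.0.3). No rate in `1 − |a|/M`. -/
def BulkTeukolskySlabLaw : Prop :=
  ∀ [Kerr.Facts], ∀ a₁ : ℝ, a₁ < 1 → ∃ (k : ℕ) (w : ℝ),
    ∀ M₀ : ℝ, 0 < M₀ → ∀ R : ℝ, ∃ C : ℝ, 1 ≤ C ∧ ∀ M : ℝ, M₀ / 2 ≤ M → M ≤ 2 * M₀ →
      ∀ a : ℝ, |a| ≤ a₁ * M → Kerr.TeukolskySlabLawOn M a M k w R C

/-! ### §0b (skeleton v3, lead c6) The reshape of `L`: unit-mass core and dilation covariance -/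

/-- **`L₁` — the unit-mass core of `L`** (statement of STUB `stub_unitMassSlabLaw`): the a-uniform slab law
at mass `M = 1` and inner radius `r₀ = 1`: for every `a₁ < 1` ONE regularity `(k, w)` and, per radius `R`,
ONE constant `C ≥ 1` give `Kerr.TeukolskySlabLawOn 1 a 1 k w R C` for every `|a| ≤ a₁`. Exactly the unprinted
clause of `L` (a-uniformity of the INHOMOGENEOUS `s = ±2` law on a compact sub-extremal spin set — lead a1's F2)
with the mass scaled out; `L` follows by `SlabLawDilate` and `slabLaw_anti_radius`. Per spin in print: SR–TdC
arXiv:2302.08916 Thm A (homogeneous), Ma–Szeftel arXiv:2603.23437 Thm 1.2 + Rem 1.3 (inhomogeneous, exact Kerr).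
-/
def UnitMassSlabLaw : Prop :=
  ∀ [Kerr.Facts], ∀ a₁ : ℝ, a₁ < 1 → ∃ (k : ℕ) (w : ℝ), ∀ R : ℝ, ∃ C : ℝ, 1 ≤ C ∧
    ∀ a : ℝ, |a| ≤ a₁ → Kerr.TeukolskySlabLawOn 1 a 1 k w R C

/-- **`D0` — the field of a slab pair is smooth off the axis and off `{Δ = 0}`** (statement of STUB
`stub_slabPair_contDiffAt`): if `(α, F)` is a sourced pair on the slab `τ₀ ≤ t* ≤ τ₁` of the chart `{r > r₀}`
(`Kerr.IsTeukolskyPairOnSlab`), then on some open neighbourhood `{τ₀ − θ < t* < τ₁ + θ}` of the closed slab the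
extension by zero of `α` is `C^∞` at every point off the axis with `Δ(r) ≠ 0`. Reason: the witness `T` of the
pair is `C^∞` there and equals `α̃ m_s ⊗ m_s = (Δ^s (r²+a²)^{-max(s,0)} α) m_s ⊗ m_s`; the component
`(m_s)₃ (m_s)₃ = r² sin²θ = r²ϖ²/(r² + a²)` and the rescaling factor are `C^∞` and non-vanishing on the open set
`{r > 0, ϖ ≠ 0, Δ ≠ 0}` (`Kerr.contDiffAt_radius_comp`), so `α = T₃₃ / (smooth ≠ 0)` locally. -/
def SlabPairContDiff : Prop :=
  ∀ [Kerr.Facts] (M a r₀ : ℝ) [(Kerr.metric M a r₀).HasLeviCivita] (s : ℤ) (τ₀ τ₁ : ℝ)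
    (α F : Kerr.region a r₀ → ℂ), Kerr.IsTeukolskyPairOnSlab M a r₀ s τ₀ τ₁ α F →
    ∃ θ : ℝ, 0 < θ ∧ ∀ x : Kerr.region a r₀, τ₀ - θ < (x : E4) 0 → (x : E4) 0 < τ₁ + θ →
      (x : E4) ∉ Kerr.axis → Kerr.delta M a (Kerr.radius a (x : E4)) ≠ 0 →
      ContDiffAt ℝ ((⊤ : ℕ∞) : WithTop ℕ∞) (Function.extend Subtype.val α (0 : E4 → ℂ)) (x : E4)

/-- **`D1` — dilation covariance of the Teukolsky operator** (statement of STUB `stub_teukolskyOpOn_dilate`):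
for `λ > 0`, `x ∈ {r > r₀}` and a field `α` on the dilated chart `{r > λr₀}` of Kerr(`λM, λa`) whose extension is
`C²` at `λx`, `𝔗^{[s]}_{M,a,r₀}[α ∘ D_λ](x) = 𝔗^{[s]}_{λM,λa,λr₀}[α](λx)` EXACTLY (the operator
`ρ² □_g + 2s(r − M)∂_r + …` is homogeneous of degree `0` under `(M, a, x) ↦ (λM, λa, λx)`:
`Kerr.dalembertian_eq_waveOperator`, `KerrSchild.waveOperator_comp_smul`, `Kerr.scalarH_dilate`,
`Kerr.nullVector_dilate`, `Kerr.radius_smul`; the coordinate derivatives `coordDeriv` scale by `λ`, the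
Boyer–Lindquist vectors `blRadialVector` / `blAxialVector` by `1` / `λ`, `cos θ`, `sin θ` are invariant). Both
Levi-Civita instances are hypotheses (Prop-valued, inhabited by `PseudoRiemannianMetric.hasLeviCivita`). -/
def TeukolskyOpDilate : Prop :=
  ∀ [Kerr.Facts] (lam : ℝ) (hlam : 0 < lam) (M a r₀ : ℝ)
    [(Kerr.metric M a r₀).HasLeviCivita] [(Kerr.metric (lam * M) (lam * a) (lam * r₀)).HasLeviCivita]
    (s : ℤ) (α : Kerr.region (lam * a) (lam * r₀) → ℂ) (x : Kerr.region a r₀),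
    ContDiffAt ℝ 2 (Function.extend Subtype.val α (0 : E4 → ℂ)) (lam • (x : E4)) →
    Kerr.teukolskyOpOn M a r₀ s
        (fun y : Kerr.region a r₀ ↦ α ⟨lam • (y : E4), (Kerr.mem_region_dilate_iff hlam).2 y.2⟩) x =
      Kerr.teukolskyOpOn (lam * M) (lam * a) (lam * r₀) s α
        ⟨lam • (x : E4), (Kerr.mem_region_dilate_iff hlam).2 x.2⟩

/-- **`D2` — slab pairs pull back along the dilation** (statement of STUB `stub_slabPair_dilate`, which takes
`D1` and `D0` as hypotheses): a sourced pair `(α, F)` on the slab `[τ₀, τ₁]` of the chart `{r > λr₀}` of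
Kerr(`λM, λa`) pulls back under `D_λ : x ↦ λx` to the sourced pair `(α ∘ D_λ, F ∘ D_λ)` on the slab
`[τ₀/λ, τ₁/λ]` of the chart `{r > r₀}` of Kerr(`M, a`) (witnesses `λ^{-m(s)} • (T ∘ D_λ)`, `λ^{-m(s)} • (S ∘ D_λ)`,
`m(s) = 2 + 2s − 2max(s, 0)`, on the neighbourhood of half-width `θ/λ`; the frame scales by `λ`
(`Kerr.frameM (λa) (λx) = λ • Kerr.frameM a x`), the rescaling by `λ^{2s − 2max(s,0)}`; the equation by `D1`,
the `C²` hypothesis of `D1` by `D0`). -/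
def SlabPairDilate : Prop :=
  ∀ [Kerr.Facts] (lam : ℝ) (hlam : 0 < lam) (M a r₀ : ℝ)
    [(Kerr.metric M a r₀).HasLeviCivita] [(Kerr.metric (lam * M) (lam * a) (lam * r₀)).HasLeviCivita]
    (s : ℤ) (τ₀ τ₁ : ℝ) (α F : Kerr.region (lam * a) (lam * r₀) → ℂ),
    Kerr.IsTeukolskyPairOnSlab (lam * M) (lam * a) (lam * r₀) s τ₀ τ₁ α F →
    Kerr.IsTeukolskyPairOnSlab M a r₀ s (τ₀ / lam) (τ₁ / lam)
      (fun y : Kerr.region a r₀ ↦ α ⟨lam • (y : E4), (Kerr.mem_region_dilate_iff hlam).2 y.2⟩)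
      (fun y : Kerr.region a r₀ ↦ F ⟨lam • (y : E4), (Kerr.mem_region_dilate_iff hlam).2 y.2⟩)

/-- **`D3` — the weighted energies are dilation-comparable** (statement of STUB `stub_teukolskyEnergyOn_dilate`):
for `λ` in a compact range `[lo, hi] ⊂ (0, ∞)` the `k`-th order `(1 + ‖y‖)^p`-weighted energy of `α̃ m_s ⊗ m_s`
through `{t* = λτ} ∩ {y ∈ λ • A}` on the chart `{r > λr₀}` of Kerr(`λM, λa`) and that of
`(α ∘ D_λ)~ m_s ⊗ m_s` through `{t* = τ} ∩ {y ∈ A}` on `{r > r₀}` of Kerr(`M, a`) bound each other up to a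
constant `K(s, k, p, lo, hi)`: the tensorised rescaled fields satisfy `T_dil(λz) = λ^{m(s)} T(z)` identically
(junk values included), `‖D^j (T_dil)‾(λz)‖ = λ^{m(s) − j} ‖D^j T‾(z)‖`, Lebesgue measure scales by `λ³`
(`MeasureTheory.Measure.addHaar_smul`), `E4.ofTimeSpace (λτ) (λy) = λ • E4.ofTimeSpace τ y`
(`Kerr.smul_ofTimeSpace`), and `(1 + ‖λy‖)^p ≤ max(λ, λ⁻¹)^{|p|} (1 + ‖y‖)^p`. -/
def TeukolskyEnergyDilate : Prop :=
  ∀ (s : ℤ) (k : ℕ) (p lo hi : ℝ) (hlo : 0 < lo), lo ≤ hi → ∃ K : ℝ, 0 < K ∧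
    ∀ (lam : ℝ) (hlam : lo ≤ lam), lam ≤ hi →
      ∀ (M a r₀ : ℝ) (α : Kerr.region (lam * a) (lam * r₀) → ℂ) (τ : ℝ) (A : Set E3),
        Kerr.teukolskyEnergyOn (lam * M) (lam * a) (lam * r₀) s α (lam * τ) k p (lam • A) ≤
            ENNReal.ofReal K * Kerr.teukolskyEnergyOn M a r₀ s
              (fun y : Kerr.region a r₀ ↦
                α ⟨lam • (y : E4), (Kerr.mem_region_dilate_iff (hlo.trans_le hlam)).2 y.2⟩) τ k p A ∧
          Kerr.teukolskyEnergyOn M a r₀ s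
              (fun y : Kerr.region a r₀ ↦
                α ⟨lam • (y : E4), (Kerr.mem_region_dilate_iff (hlo.trans_le hlam)).2 y.2⟩) τ k p A ≤
            ENNReal.ofReal K *
              Kerr.teukolskyEnergyOn (lam * M) (lam * a) (lam * r₀) s α (lam * τ) k p (lam • A)

/-- **`D4` — dilation covariance of the slab law** (statement of STUB `stub_slabLaw_dilate`, which takes `D2`
and `D3` as hypotheses): for `λ ∈ [lo, hi] ⊂ (0, ∞)` ONE constant `K(k, w, lo, hi) ≥ 1` transports the law,
`TeukolskySlabLawOn M a r₀ k w R Λ → TeukolskySlabLawOn (λM) (λa) (λr₀) k w (λR) (KΛ)` (pull the pair back by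
`D2`, apply the law on the slab `[τ₀/λ, τ₁/λ]`, push the energies forward by `D3`; the time integrals substitute
`τ = λσ`; `λ • closedBall 0 R = closedBall 0 (λR)`, `λ • univ = univ`). Mass-local uniformity of `L` is this. -/
def SlabLawDilate : Prop :=
  ∀ [Kerr.Facts] (k : ℕ) (w lo hi : ℝ), 0 < lo → lo ≤ hi → ∃ K : ℝ, 1 ≤ K ∧
    ∀ lam : ℝ, lo ≤ lam → lam ≤ hi → ∀ (M a r₀ R Λ : ℝ), 0 ≤ Λ →
      Kerr.TeukolskySlabLawOn M a r₀ k w R Λ →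
      Kerr.TeukolskySlabLawOn (lam * M) (lam * a) (lam * r₀) k w (lam * R) (K * Λ)

/-- **Background bound at one spin** — VERBATIM `BackgroundBoundAt` of the rank-2 line
`Cruxes/NearExtremalKappaCapture/Lines/polynomial_closure.lean` (leg β): on `{x⁰ = 0, M ≤ r_a(x) ≤ R}` every
joint `(a, x)`-derivative of order `≤ n` of the Kerr–Schild scalar `H` and null covector `ℓ` has norm `≤ B`. -/
def BackgroundBoundAt (M a : ℝ) (n : ℕ) (R B : ℝ) : Prop :=
  ∀ x : E4, x 0 = 0 → M ≤ Kerr.radius a x → Kerr.radius a x ≤ R → ∀ j : ℕ, j ≤ n →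
    ‖iteratedFDeriv ℝ j (fun q : ℝ × E4 ↦ Kerr.scalarH M q.1 q.2) (a, x)‖ ≤ B ∧
      ∀ μ : Fin 4, ‖iteratedFDeriv ℝ j (fun q : ℝ × E4 ↦ Kerr.nullCovectorFun q.1 q.2 μ) (a, x)‖ ≤ B

/-- **`BackgroundUniform`** (leg β of the rank-2 line; LANDED p77983 as
`Theorems.NearExtremalKappaCapture.PolynomialClosure.stub_backgroundUniform`) — NOT a stub of this line. -/
def BackgroundUniform : Prop :=
  ∀ M : ℝ, 0 < M → ∀ (n : ℕ) (R : ℝ), ∃ B : ℝ, 1 ≤ B ∧ ∀ a : ℝ, |a| ≤ M →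
    BackgroundBoundAt M a n R B

/-- `BackgroundUniform` holds: the landed theorem (p77983), by definitional unfolding. [folklore] -/
theorem backgroundUniform_holds : BackgroundUniform :=
  Theorems.NearExtremalKappaCapture.PolynomialClosure.stub_backgroundUniform

/-- The constant-coefficient Killing combination `T + cΦ = ∂₀ + c(x₁∂₂ − x₂∂₁)` at `x`. -/
def killingComb (c : ℝ) (x : E4) : E4 := E4.basisVector 0 + c • Kerr.axialVector x

/-- **Timelike Killing shells at one spin.** On every shell `{|r_a(x) − r₀| ≤ d·M}` centred at a radius
`r₀ ∈ [r₊ + c₁M, R·M]` the CONSTANT Killing field `T + ω(r₀)Φ` (`ω = Kerr.drsrAngularVelocity`, DRSR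
Lemma 4.7.1's profile frozen at the centre of the shell) is uniformly timelike: `g(V, V) ≤ −μ`. -/
def ShellsAt (M a c₁ R d μ : ℝ) : Prop :=
  ∀ r₀ : ℝ, Kerr.rPlus M a + c₁ * M ≤ r₀ → r₀ ≤ R * M →
    ∀ x : E4, |Kerr.radius a x - r₀| ≤ d * M →
      Kerr.bilin M a x (killingComb (Kerr.drsrAngularVelocity M a r₀) x)
          (killingComb (Kerr.drsrAngularVelocity M a r₀) x) ≤ -μ

/-- **`S` — uniform timelike Killing shells at bounded surface gravity** (statement of STUB
`stub_uniformKillingShells`). For every `a₁ < 1`, inner margin `c₁ > 0` and outer radius `R` there are a shell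
half-width `d > 0` and a margin `μ > 0`, BOTH INDEPENDENT OF `(M, a)`, with `ShellsAt M a c₁ R d μ` for every
`M > 0`, `|a| ≤ a₁M`. Quantitative shell-uniform DRSR arXiv:1402.7034 Lemma 4.7.1. -/
def UniformKillingShells : Prop :=
  ∀ a₁ : ℝ, a₁ < 1 → ∀ c₁ R : ℝ, 0 < c₁ → ∃ d > (0 : ℝ), ∃ μ > (0 : ℝ),
    ∀ M : ℝ, 0 < M → ∀ a : ℝ, |a| ≤ a₁ * M → ShellsAt M a c₁ R d μ

/-- **`P` — packet closing box at order two** (statement of STUB `stub_packetClosingBoxC2`, the line's open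
nonlinear debt): the Einstein-vacuum analogue at bounded κ of Dafermos–Holzegel–Rodnianski–Taylor
arXiv:2410.03639 Thm 5.1, with the shell data `(c₁, d, μ)`, the linear constant `Λ` (slab law on the parameter
box `|M' − M| + |a' − a| ≤ Mχ/8`, `χ = 1 − (a/M)²`) and the background constant `B` as INPUTS, and ONE basin /
ONE Lipschitz constant serving every `|a| ≤ a₁M` as OUTPUT. -/
def PacketClosingBoxC2 : Prop :=
  ∀ [Kerr.Facts] [Kerr.SliceFacts], ∀ (k : ℕ) (w : ℝ), ∀ a₁ : ℝ, a₁ < 1 → ∃ (s : ℕ) (δ : ℝ),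
    ∀ (M : ℝ) (hM : 0 < M), ∃ (R : ℝ) (n : ℕ) (c₁ : ℝ), 0 < c₁ ∧
      ∀ d μ Λ B : ℝ, 0 < d → 0 < μ → 1 ≤ Λ → 1 ≤ B →
        ∃ ε > (0 : ℝ), ∃ C : ℝ, ∀ a : ℝ, |a| ≤ a₁ * M →
          ShellsAt M a c₁ R d μ →
          (∀ M' a' : ℝ, |M' - M| + |a' - a| ≤ M * (1 - (a / M) ^ 2) / 8 →
              Kerr.TeukolskySlabLawOn M' a' M' k w R Λ) →
          BackgroundBoundAt M a n R B →
          CaptureAt s δ 2 M hM.le ε C a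

/-- **`P∃` — packet closing box at order two, EXISTENTIAL (printed) form** (statement of STUB
`stub_packetClosingBoxExists`, the line's open nonlinear debt since skeleton v5): verbatim `P` with the conclusion
`CaptureAt s δ 2 M _ ε C a` (ALL maximal developments far-complete and `C²`-converging) replaced by "every
vacuum-constraint datum in the `H^s_δ`-ball of radius `ε` has ONE vacuum Cauchy development which is far-complete
(`DataEmbedding.HasCompleteFutureNullInfinityFar`) and has a region converging in `C²` to a sub-extremal `g_{M',a'}`
with `|M' − M| + |a' − a| ≤ C √dist`" — the output of a bootstrap. `P∃ ⇒ P` by the landed ascent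
(`Theorems.BulkKerrCaptureC2.CaptureAscent.stub_captureAt_of_forall_exists`, p125190); `P ⇒ P∃` only modulo EXISTENCE
of a (maximal) vacuum Cauchy development of each datum in the ball (`packetClosingBoxExists_of_packetClosingBoxC2`): on a
datum WITHOUT any development `P` is vacuous while `P∃` fails, so `P∃` additionally asserts local existence — a printed
theorem for the smooth (`InitialDataSet`: `C^∞` fields) vacuum-constraint data at hand (Choquet-Bruhat 1952;
Choquet-Bruhat–Geroch 1969, tree name `choquetBruhat_geroch_exists_mghd_cauchy`, unproved), and exactly what a stability
proof constructs. -/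
def PacketClosingBoxExists : Prop :=
  ∀ [Kerr.Facts] [Kerr.SliceFacts], ∀ (k : ℕ) (w : ℝ), ∀ a₁ : ℝ, a₁ < 1 → ∃ (s : ℕ) (δ : ℝ),
    ∀ (M : ℝ) (hM : 0 < M), ∃ (R : ℝ) (n : ℕ) (c₁ : ℝ), 0 < c₁ ∧
      ∀ d μ Λ B : ℝ, 0 < d → 0 < μ → 1 ≤ Λ → 1 ≤ B →
        ∃ ε > (0 : ℝ), ∃ C : ℝ, ∀ a : ℝ, |a| ≤ a₁ * M →
          ShellsAt M a c₁ R d μ →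
          (∀ M' a' : ℝ, |M' - M| + |a' - a| ≤ M * (1 - (a / M) ^ 2) / 8 →
              Kerr.TeukolskySlabLawOn M' a' M' k w R Λ) →
          BackgroundBoundAt M a n R B →
          ∀ (D : InitialDataSet 𝓘(ℝ, E3) (Kerr.slice a M)) [D.metric.HasLeviCivita],
            D.IsVacuumConstraintSolution →
            InitialDataSet.dataWeightedSobolevEDist s δ D (Kerr.data M a M hM.le) < ENNReal.ofReal ε →
            ∃ (𝒟₀ : VacuumCauchyDevelopment D) (M' a' : ℝ) (𝒟oc : Set 𝒟₀.carrier),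
              Kerr.IsSubextremal M' a' ∧ 𝒟₀.HasCompleteFutureNullInfinityFar ∧
              𝒟₀.toSpacetime.ConvergesToKerr 𝒟oc M' a' 2 ∧
              |M' - M| + |a' - a| ≤
                C * √(InitialDataSet.dataWeightedSobolevEDist s δ D (Kerr.data M a M hM.le)).toReal

/-- **`T` — bulk closing box at order two** (the HUB statement of card `bounded-kappa-closing-box`; NOT a stub
of this line — it is supplied by `S ∧ P`, `bulkClosingBoxC2_of_packets`): `P` with the shell hypothesis
deleted. The door-agnostic form of the nonlinear transfer at bounded κ; implied by the rank-2 transfer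
`PolynomialClosingBox` ONCE its convergence order is pinned to `kc := 2` (§4 — the registered stub 3″ has
`∃ kc` today, `polynomial_closure.lean` l.166, as all three triagers point out). -/
def BulkClosingBoxC2 : Prop :=
  ∀ [Kerr.Facts] [Kerr.SliceFacts], ∀ (k : ℕ) (w : ℝ), ∀ a₁ : ℝ, a₁ < 1 → ∃ (s : ℕ) (δ : ℝ),
    ∀ (M : ℝ) (hM : 0 < M), ∃ (R : ℝ) (n : ℕ), ∀ Λ B : ℝ, 1 ≤ Λ → 1 ≤ B →
      ∃ ε > (0 : ℝ), ∃ C : ℝ, ∀ a : ℝ, |a| ≤ a₁ * M →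
        (∀ M' a' : ℝ, |M' - M| + |a' - a| ≤ M * (1 - (a / M) ^ 2) / 8 →
            Kerr.TeukolskySlabLawOn M' a' M' k w R Λ) →
        BackgroundBoundAt M a n R B →
        CaptureAt s δ 2 M hM.le ε C a

/-- **`StrongCaptureTwo` — the normal form of the line's output**: the pre-ruling strong-form bulk capture
(`Theses.PhaseMixingCapture.BulkKerrCapture`, support item) with the convergence order pinned to `2`; exactly
the hypothesis of the landed `bulkKerrCaptureC2_of_captureAt_two`. STRONGER than the crux. -/
def StrongCaptureTwo : Prop :=
  ∀ [Kerr.Facts] [Kerr.SliceFacts], ∀ a₁ : ℝ, a₁ < 1 → ∃ (s : ℕ) (δ : ℝ),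
    ∀ (M : ℝ) (hM : 0 < M), ∃ ε > (0 : ℝ), ∃ C : ℝ, ∀ a : ℝ, |a| ≤ a₁ * M →
      CaptureAt s δ 2 M hM.le ε C a

/-! ## §1 The registered stubs (statements expanded over the tree vocabulary) -/

/-- **STUB `S` — CLOSED (landed p117565, `Theorems.BulkKerrCaptureC2.KillingShells.stub_uniformKillingShells`,
292 lines, compactness at `M = 1` + exact scaling)** — `UniformKillingShells`, expanded. Why true:
`Kerr.bilin_basisVector_add_smul_axialVector` writes `g(T + cΦ, T + cΦ)` as a rational function of
`(r, σ = sin²θ, a, M, c)`; at `r = r₀ > r₊` it is `< 0` (`Kerr.bilin_drsrVector_neg`, DRSR Lemma 4.7.1 —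
`shellCentre_timelike`); the parameter set `{|a| ≤ a₁} × {r₀ ∈ [r₊(a) + c₁, R]} × {σ ∈ [0, 1]}` at `M = 1` is
compact, so `IsCompact.exists_isMaxOn` + uniform continuity give `(d, μ)`; exact scaling
`(M, a, r₀, x) ↦ λ(·)` (`H`, `ℓ`, `∂₀`, `ω(r₀)Φ` are scale-invariant) transports them to every `M > 0`. On the
axis `Φ = 0` and `g(T, T) = −Δ/(r² + a²) < 0`. Vacuous for `a₁ < 0` and for `RM < r₊ + c₁M`. Why it might
fail: only by a typo-level sign/junk issue (`Kerr.radius` of points inside the shell is `≥ r₀ − dM > r₊ > 0`,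
off the ring); numerics: sup over shells `= −3.6e-4 … −1.4e-1 < 0` for `d = c₁/4` at all
`(a₁, c₁) ∈ {.5, .9, .99, .999} × {.5, .1, .02}` (r2-1 `shells_check.py`, r2-3 `shells_scan.py`).
[cite: DafermosRodnianskiShlapentokhrothman2014, Lemma 4.7.1] -/
theorem stub_uniformKillingShells :
    ∀ a₁ : ℝ, a₁ < 1 → ∀ c₁ R : ℝ, 0 < c₁ → ∃ d > (0 : ℝ), ∃ μ > (0 : ℝ),
      ∀ M : ℝ, 0 < M → ∀ a : ℝ, |a| ≤ a₁ * M →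
        ∀ r₀ : ℝ, Kerr.rPlus M a + c₁ * M ≤ r₀ → r₀ ≤ R * M →
          ∀ x : E4, |Kerr.radius a x - r₀| ≤ d * M →
            Kerr.bilin M a x
                (E4.basisVector 0 + Kerr.drsrAngularVelocity M a r₀ • Kerr.axialVector x)
                (E4.basisVector 0 + Kerr.drsrAngularVelocity M a r₀ • Kerr.axialVector x) ≤ -μ :=
  -- LANDED p117565 (stub-worker, wave 1 of lead a1): Theorems/PhaseMixingCaptureBulkKerrCaptureC2UniformKillingShells.lean
  Theorems.BulkKerrCaptureC2.KillingShells.stub_uniformKillingShells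

/-- **STUB `L` (XL, LINEAR, exact Kerr; shared currency with ranks 2/3 at spin ±2)** —
`BulkTeukolskySlabLaw`, expanded. Why plausibly true: per spin it is in print — boundedness + ILED for the
Teukolsky system on the full sub-extremal range (Shlapentokh-Rothman–Teixeira da Costa arXiv:2007.07211 +
arXiv:2302.08916 Thm A, horizon-crossing class, homogeneous), and the INHOMOGENEOUS energy–Morawetz form on
exact Kerr (Ma–Szeftel arXiv:2603.23437 Thm 1.2 restricted to Kerr, Rem 1.3 p. 7, regularity
`(k₊₂, k₋₂) = (11, 14)`); real-axis mode stability is a tree theorem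
(`Kerr.Costa2019_realAxisModeStability_holds`); mass-local uniformity is scaling. Why it might fail / what is
NOT printed: uniformity of the constant on the compact spin set `|a| ≤ a₁M` (printed only for the scalar
analogue, DHRT arXiv:2410.03639 Rem 5.0.3 p. 58: constants "depend smoothly on a for 0 < |a| < M"); the
translation of the printed norms into `Kerr.teukolskyEnergyOn … k w` (weights `(1 + ‖y‖)^w`, `k`-th order data
and source energies) may force a larger `k` than printed — harmless, `(k, w)` is existential. Negation = for
some `a₁ < 1` and every `(k, w)` the best constant is infinite somewhere on `|a| ≤ a₁M` — a desk contradiction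
with SR–TdC at that spin. [cite: ShlapentokhrothmanCosta2023, Thm A] -/
theorem L_statement_record :
    BulkTeukolskySlabLaw ↔ ∀ [Kerr.Facts], ∀ a₁ : ℝ, a₁ < 1 → ∃ (k : ℕ) (w : ℝ),
      ∀ M₀ : ℝ, 0 < M₀ → ∀ R : ℝ, ∃ C : ℝ, 1 ≤ C ∧ ∀ M : ℝ, M₀ / 2 ≤ M → M ≤ 2 * M₀ →
        ∀ a : ℝ, |a| ≤ a₁ * M → Kerr.TeukolskySlabLawOn M a M k w R C :=
  -- `L` is no longer a registered stub (skeleton v3): it is the THEOREM `bulkTeukolskySlabLaw_of_unitMass`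
  -- below, from the registered stubs `L₁`, `D0`–`D4`. This `Iff.rfl` records its statement verbatim.
  Iff.rfl

/-! ### §1b (skeleton v3, lead c6) The registered stubs replacing `L`: `L₁`, `D0`, `D1`, `D2`, `D3`, `D4` -/

/-- **STUB `L₁` (LINEAR, exact Kerr at UNIT MASS; the line's irreducible linear debt)** — `UnitMassSlabLaw`,
expanded. Why plausibly true: per spin `|a| < 1` it is the printed sub-extremal Teukolsky estimate in the DHRT
(1.3) slab format (boundedness + integrated local energy decay with loss of derivatives at trapping, sourced):
Shlapentokh-Rothman–Teixeira da Costa arXiv:2007.07211 + arXiv:2302.08916 Thm A / Thm 5.1 (homogeneous,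
horizon-crossing class, constants `C(a₀, M, |s|, δ, p)` uniform on `|a| ≤ a₀ < M` for the HOMOGENEOUS exterior
problem), Ma–Szeftel arXiv:2603.23437 Thm 1.2 + Rem 1.3 p. 7 (inhomogeneous, exact Kerr), real-axis mode
stability `Kerr.Costa2019_realAxisModeStability_holds`. What is NOT printed (lead a1's L-audit, F1/F2): the
inhomogeneous law in exactly this format (source norm = time-integrated weighted `k`-th order energy; inner
boundary `r₀ = 1 ∈ (r₋, r₊)`), and the uniformity of ONE constant on the compact spin set for `s = ±2`
(scalar analogue printed: DHRT arXiv:2410.03639 Rem 5.0.3 p. 58). Why it might fail: only through the format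
translation forcing a larger `k`/`w` than printed (harmless: existential) — a genuine failure of uniformity at
some `|a| ≤ a₁ < 1` would contradict SR–TdC at that spin. No Lean attack either way (every refutation needs an
explicit pair with infinite best constant; every proof is the SR–TdC/Ma–Szeftel analysis).
[cite: ShlapentokhrothmanCosta2023, Thm A] -/
theorem stub_unitMassSlabLaw :
    ∀ [Kerr.Facts], ∀ a₁ : ℝ, a₁ < 1 → ∃ (k : ℕ) (w : ℝ), ∀ R : ℝ, ∃ C : ℝ, 1 ≤ C ∧
      ∀ a : ℝ, |a| ≤ a₁ → Kerr.TeukolskySlabLawOn 1 a 1 k w R C := by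
  sorry

/-- **STUB `D0` — CLOSED (landed p120331, 196 lines)** — `SlabPairContDiff`, expanded: the field of a slab pair is `C^∞`
(as its extension by zero to `E4`) at every point of the open slab neighbourhood off the axis and off `{Δ = 0}`.
Proof route: from `Kerr.IsTeukolskyPairOnSlab` take `θ` and the smooth witness `T` with
`T x = Kerr.tensorise a s (Kerr.rescale M a s α) x` there; the `(3,3)` component reads
`T x 3 3 = (Δ^s (r²+a²)^{-max(s,0)}) · α x · (r sin θ)²` (`Kerr.spinFrame`/`Kerr.frameM`: the last component is
the real `−r sin θ` for both `m` and `m̄`), and on the OPEN set `{τ₀ − θ < x⁰ < τ₁ + θ} ∩ {ϖ ≠ 0} ∩ {Δ(r) ≠ 0}`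
(inside `{r > max r₀ 0}`) the factor is `C^∞` (`Kerr.contDiffAt_radius_comp`; `sin θ = ϖ/√(r²+a²)`,
`ϖ = √(x₁² + x₂²)` smooth off the axis) and non-zero, so the extension of `α` agrees near `x` with
`(T‾ 3 3) / factor`, a `C^∞` function (`OpensChart.contMDiffAt_iff` for the representative of `T`).
[cite: DafermosHolzegelRodnianski2019, §2.2.1] -/
theorem stub_slabPair_contDiffAt :
    ∀ [Kerr.Facts] (M a r₀ : ℝ) [(Kerr.metric M a r₀).HasLeviCivita] (s : ℤ) (τ₀ τ₁ : ℝ)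
      (α F : Kerr.region a r₀ → ℂ), Kerr.IsTeukolskyPairOnSlab M a r₀ s τ₀ τ₁ α F →
      ∃ θ : ℝ, 0 < θ ∧ ∀ x : Kerr.region a r₀, τ₀ - θ < (x : E4) 0 → (x : E4) 0 < τ₁ + θ →
        (x : E4) ∉ Kerr.axis → Kerr.delta M a (Kerr.radius a (x : E4)) ≠ 0 →
        ContDiffAt ℝ ((⊤ : ℕ∞) : WithTop ℕ∞) (Function.extend Subtype.val α (0 : E4 → ℂ)) (x : E4) :=
  -- LANDED p120331 (stub-worker, wave 1 of lead c6): Theorems/PhaseMixingCaptureBulkKerrCaptureC2SlabPairContDiff.lean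
  Theorems.BulkKerrCaptureC2.SlabPairContDiff.stub_slabPair_contDiffAt

/-- **STUB `D1` — CLOSED (landed p120876, 296 lines)** — `TeukolskyOpDilate`, expanded: exact dilation covariance of
`Kerr.teukolskyOpOn`. Proof route: unfold `Kerr.teukolskyOpOn`; (i) `Kerr.cdalembertianOn` = `□` of the real and
imaginary parts for `Kerr.metric M a r₀` = (same components, `rfl` on the Koszul formula, cf.
`Kerr.leviCivita_smoothMetric_eq`) `□` for `Kerr.smoothMetric M a r₀`, which `Kerr.dalembertian_eq_waveOperator`
(under `haveI := Kerr.sliceFacts_holds`) writes as `KerrSchild.waveOperator` of the Kerr–Schild coefficients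
`(2H, ℓ♯)`; these are dilation invariant (`Kerr.scalarH_dilate`, `Kerr.nullVector_dilate`), so
`KerrSchild.waveOperator_comp_smul` gives `□_{M,a}(Φ ∘ (λ•))(x) = λ² (□_{λM,λa} Φ)(λx)`, and `ρ² = r² + a²cos²θ`
scales by `λ²`; (ii) `Kerr.coordDeriv (α ∘ D_λ) x v = λ · Kerr.coordDeriv α (λx) v` (chain rule for the
extension by zero, which is `(extension of α) ∘ (λ•)`), `Kerr.blRadialVector (λM) (λa) (λx) = Kerr.blRadialVector M a x`,
`Kerr.blAxialVector (λx) = λ • Kerr.blAxialVector x`, `Kerr.cosTheta`/`Kerr.sinTheta` invariant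
(`Kerr.radius_smul`), `Kerr.delta (λM) (λa) (λr) = λ² Kerr.delta M a r`: every first-order coefficient absorbs
exactly one `λ`; (iii) the zeroth-order term is invariant. [cite: TeukolskyPress1974, §II] -/
theorem stub_teukolskyOpOn_dilate :
    ∀ [Kerr.Facts] (lam : ℝ) (hlam : 0 < lam) (M a r₀ : ℝ)
      [(Kerr.metric M a r₀).HasLeviCivita] [(Kerr.metric (lam * M) (lam * a) (lam * r₀)).HasLeviCivita]
      (s : ℤ) (α : Kerr.region (lam * a) (lam * r₀) → ℂ) (x : Kerr.region a r₀),
      ContDiffAt ℝ 2 (Function.extend Subtype.val α (0 : E4 → ℂ)) (lam • (x : E4)) →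
      Kerr.teukolskyOpOn M a r₀ s
          (fun y : Kerr.region a r₀ ↦ α ⟨lam • (y : E4), (Kerr.mem_region_dilate_iff hlam).2 y.2⟩) x =
        Kerr.teukolskyOpOn (lam * M) (lam * a) (lam * r₀) s α
          ⟨lam • (x : E4), (Kerr.mem_region_dilate_iff hlam).2 x.2⟩ :=
  -- LANDED p120876 (stub-worker, wave 1 of lead c6): Theorems/PhaseMixingCaptureBulkKerrCaptureC2TeukolskyOpDilate.lean
  Theorems.BulkKerrCaptureC2.TeukolskyOpDilate.stub_teukolskyOpOn_dilate

/-- **STUB `D2` — CLOSED (landed p121404, 321 lines; hypotheses = the registered statements of `D1` and `D0`)** — slab pairs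
pull back along the dilation (`SlabPairDilate`), expanded. Proof route: from the pair on the dilated chart take
`θ`, `T`, `S`; use `θ/λ`, `λ^{-m(s)} • (T ∘ D_λ)`, `λ^{-m(s)} • (S ∘ D_λ)` with `m(s) = 2 + 2s − 2max(s,0)`
(`Kerr.tensorise (λa) s f (λx) = λ² • …`, `Kerr.rescale (λM) (λa) s α (λx) = λ^{2s−2max(s,0)} • …`, from
`Kerr.radius_smul`, the invariance of `Kerr.cosTheta`/`Kerr.sinTheta` and `Kerr.frameM (λa) (λx) = λ • Kerr.frameM a x`);
smoothness of the composites by `ContMDiffOn.comp` with the smooth dilation between the charts (model: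
`Kerr.contMDiff_sliceShrink`, `mfderiv_sliceShrink_apply` of `KerrSliceDilation.lean`); the axis and `{Δ = 0}`
are dilation invariant; the equation clause is hypothesis `D1`, whose `C²` premise is hypothesis `D0` applied to
the dilated pair. [cite: DafermosHolzegelRodnianskiTaylor2022, §1.1 (1.3)] -/
theorem stub_slabPair_dilate :
    (∀ [Kerr.Facts] (lam : ℝ) (hlam : 0 < lam) (M a r₀ : ℝ)
      [(Kerr.metric M a r₀).HasLeviCivita] [(Kerr.metric (lam * M) (lam * a) (lam * r₀)).HasLeviCivita]
      (s : ℤ) (α : Kerr.region (lam * a) (lam * r₀) → ℂ) (x : Kerr.region a r₀),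
      ContDiffAt ℝ 2 (Function.extend Subtype.val α (0 : E4 → ℂ)) (lam • (x : E4)) →
      Kerr.teukolskyOpOn M a r₀ s
          (fun y : Kerr.region a r₀ ↦ α ⟨lam • (y : E4), (Kerr.mem_region_dilate_iff hlam).2 y.2⟩) x =
        Kerr.teukolskyOpOn (lam * M) (lam * a) (lam * r₀) s α
          ⟨lam • (x : E4), (Kerr.mem_region_dilate_iff hlam).2 x.2⟩) →
    (∀ [Kerr.Facts] (M a r₀ : ℝ) [(Kerr.metric M a r₀).HasLeviCivita] (s : ℤ) (τ₀ τ₁ : ℝ)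
      (α F : Kerr.region a r₀ → ℂ), Kerr.IsTeukolskyPairOnSlab M a r₀ s τ₀ τ₁ α F →
      ∃ θ : ℝ, 0 < θ ∧ ∀ x : Kerr.region a r₀, τ₀ - θ < (x : E4) 0 → (x : E4) 0 < τ₁ + θ →
        (x : E4) ∉ Kerr.axis → Kerr.delta M a (Kerr.radius a (x : E4)) ≠ 0 →
        ContDiffAt ℝ ((⊤ : ℕ∞) : WithTop ℕ∞) (Function.extend Subtype.val α (0 : E4 → ℂ)) (x : E4)) →
    ∀ [Kerr.Facts] (lam : ℝ) (hlam : 0 < lam) (M a r₀ : ℝ)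
      [(Kerr.metric M a r₀).HasLeviCivita] [(Kerr.metric (lam * M) (lam * a) (lam * r₀)).HasLeviCivita]
      (s : ℤ) (τ₀ τ₁ : ℝ) (α F : Kerr.region (lam * a) (lam * r₀) → ℂ),
      Kerr.IsTeukolskyPairOnSlab (lam * M) (lam * a) (lam * r₀) s τ₀ τ₁ α F →
      Kerr.IsTeukolskyPairOnSlab M a r₀ s (τ₀ / lam) (τ₁ / lam)
        (fun y : Kerr.region a r₀ ↦ α ⟨lam • (y : E4), (Kerr.mem_region_dilate_iff hlam).2 y.2⟩)
        (fun y : Kerr.region a r₀ ↦ F ⟨lam • (y : E4), (Kerr.mem_region_dilate_iff hlam).2 y.2⟩) :=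
  -- LANDED p121404 (stub-worker, wave 1 of lead c6): Theorems/PhaseMixingCaptureBulkKerrCaptureC2SlabPairDilate.lean
  Theorems.BulkKerrCaptureC2.SlabPairDilate.stub_slabPair_dilate

/-- **STUB `D3` — CLOSED (landed p122447, 395 lines)** — `TeukolskyEnergyDilate`, expanded:
two-sided comparison of `Kerr.teukolskyEnergyOn` under dilation with a constant uniform for `λ ∈ [lo, hi]`.
Proof route: `Kerr.teukolskyEnergyOn = sliceSobolevEnergy (Kerr.region …) (Kerr.tensorise … (Kerr.rescale … α))`
(a `lintegral` over `E3` of an indicator times `ENNReal.ofReal ((1+‖y‖)^p Σ_{j ≤ k} ‖iteratedFDeriv ℝ j T‾ (t,y)‖²)`);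
the pointwise identity `T_dil‾ (λ • z) = λ^{m(s)} • T‾ z` on all of `E4` (junk values of `Kerr.tensorise` /
`Kerr.rescale` on the axis / `{Δ = 0}` and the zero extension outside the chart transform alike:
`Kerr.mem_region_dilate_iff`); `iteratedFDeriv` of `f ∘ (λ⁻¹ • ·)` (`ContinuousLinearEquiv.iteratedFDeriv_comp_right`
or `LinearIsometryEquiv`-free norm bounds as in `DilationDecay.norm_iteratedFDeriv_le_of_eqOn_dilation`);
`E4.ofTimeSpace (λτ) (λy) = λ • E4.ofTimeSpace τ y` (`Kerr.smul_ofTimeSpace`); change of variables `y = λx` in the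
`lintegral` (`MeasureTheory.Measure.addHaar_smul`, `lintegral` over `λ • A`); weights
`(1 + λ‖x‖)^p ≤ max(λ,λ⁻¹)^{|p|} (1 + ‖x‖)^p`; collect `K = hi³ · max(hi, lo⁻¹)^{2|m(s)| + 2k + |p|}`-type bounds
(any explicit `K` works — it is existential). [cite: arXiv08110354, §4] -/
theorem stub_teukolskyEnergyOn_dilate :
    ∀ (s : ℤ) (k : ℕ) (p lo hi : ℝ) (hlo : 0 < lo), lo ≤ hi → ∃ K : ℝ, 0 < K ∧
      ∀ (lam : ℝ) (hlam : lo ≤ lam), lam ≤ hi →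
        ∀ (M a r₀ : ℝ) (α : Kerr.region (lam * a) (lam * r₀) → ℂ) (τ : ℝ) (A : Set E3),
          Kerr.teukolskyEnergyOn (lam * M) (lam * a) (lam * r₀) s α (lam * τ) k p (lam • A) ≤
              ENNReal.ofReal K * Kerr.teukolskyEnergyOn M a r₀ s
                (fun y : Kerr.region a r₀ ↦
                  α ⟨lam • (y : E4), (Kerr.mem_region_dilate_iff (hlo.trans_le hlam)).2 y.2⟩) τ k p A ∧
            Kerr.teukolskyEnergyOn M a r₀ s
                (fun y : Kerr.region a r₀ ↦
                  α ⟨lam • (y : E4), (Kerr.mem_region_dilate_iff (hlo.trans_le hlam)).2 y.2⟩) τ k p A ≤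
              ENNReal.ofReal K *
                Kerr.teukolskyEnergyOn (lam * M) (lam * a) (lam * r₀) s α (lam * τ) k p (lam • A) :=
  -- LANDED p122447 (stub-worker, wave 1 of lead c6): Theorems/PhaseMixingCaptureBulkKerrCaptureC2TeukolskyEnergyDilate.lean
  Theorems.BulkKerrCaptureC2.TeukolskyEnergyDilate.stub_teukolskyEnergyOn_dilate

/-- **STUB `D4` — CLOSED (landed p122941, 268 lines; hypotheses = the registered statements of `D2` (conclusion form) and
`D3`)** — dilation covariance of the slab law (`SlabLawDilate`), expanded. Proof route: unfold
`Kerr.TeukolskySlabLawOn` at the dilated parameters; given its Levi-Civita instance, get the one for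
`Kerr.metric M a r₀` from `PseudoRiemannianMetric.hasLeviCivita _`; pull the pair `(α, F)` on the slab
`[τ₀, τ₁]` back by the first hypothesis to the slab `[τ₀/λ, τ₁/λ]`; bound the dilated left-hand side by the
original one with the second hypothesis at `(s, 1, 0)` (`λ • closedBall 0 R = closedBall 0 (λR)`:
`smul_closedBall'`; `∫⁻ τ in Ioo τ₀ τ₁, E(τ/λ) = λ ∫⁻ σ in Ioo (τ₀/λ) (τ₁/λ), E(σ)`: Lebesgue measure under
`σ ↦ λσ`); apply the law; bound the original right-hand side by the dilated one with the second hypothesis at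
`(s, k, w)` (`λ • univ = univ`); collect `K = max over s = ±2 of K₁K₂ · max(hi,1) · max(lo⁻¹,1)` in `ℝ≥0∞`
(`ENNReal.ofReal_mul`, `mul_le_mul'`). [cite: DafermosHolzegelRodnianskiTaylor2022, §1.1 (1.3)] -/
theorem stub_slabLaw_dilate :
    (∀ [Kerr.Facts] (lam : ℝ) (hlam : 0 < lam) (M a r₀ : ℝ)
      [(Kerr.metric M a r₀).HasLeviCivita] [(Kerr.metric (lam * M) (lam * a) (lam * r₀)).HasLeviCivita]
      (s : ℤ) (τ₀ τ₁ : ℝ) (α F : Kerr.region (lam * a) (lam * r₀) → ℂ),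
      Kerr.IsTeukolskyPairOnSlab (lam * M) (lam * a) (lam * r₀) s τ₀ τ₁ α F →
      Kerr.IsTeukolskyPairOnSlab M a r₀ s (τ₀ / lam) (τ₁ / lam)
        (fun y : Kerr.region a r₀ ↦ α ⟨lam • (y : E4), (Kerr.mem_region_dilate_iff hlam).2 y.2⟩)
        (fun y : Kerr.region a r₀ ↦ F ⟨lam • (y : E4), (Kerr.mem_region_dilate_iff hlam).2 y.2⟩)) →
    (∀ (s : ℤ) (k : ℕ) (p lo hi : ℝ) (hlo : 0 < lo), lo ≤ hi → ∃ K : ℝ, 0 < K ∧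
      ∀ (lam : ℝ) (hlam : lo ≤ lam), lam ≤ hi →
        ∀ (M a r₀ : ℝ) (α : Kerr.region (lam * a) (lam * r₀) → ℂ) (τ : ℝ) (A : Set E3),
          Kerr.teukolskyEnergyOn (lam * M) (lam * a) (lam * r₀) s α (lam * τ) k p (lam • A) ≤
              ENNReal.ofReal K * Kerr.teukolskyEnergyOn M a r₀ s
                (fun y : Kerr.region a r₀ ↦
                  α ⟨lam • (y : E4), (Kerr.mem_region_dilate_iff (hlo.trans_le hlam)).2 y.2⟩) τ k p A ∧
            Kerr.teukolskyEnergyOn M a r₀ s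
                (fun y : Kerr.region a r₀ ↦
                  α ⟨lam • (y : E4), (Kerr.mem_region_dilate_iff (hlo.trans_le hlam)).2 y.2⟩) τ k p A ≤
              ENNReal.ofReal K *
                Kerr.teukolskyEnergyOn (lam * M) (lam * a) (lam * r₀) s α (lam * τ) k p (lam • A)) →
    ∀ [Kerr.Facts] (k : ℕ) (w lo hi : ℝ), 0 < lo → lo ≤ hi → ∃ K : ℝ, 1 ≤ K ∧
      ∀ lam : ℝ, lo ≤ lam → lam ≤ hi → ∀ (M a r₀ R Λ : ℝ), 0 ≤ Λ →
        Kerr.TeukolskySlabLawOn M a r₀ k w R Λ →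
        Kerr.TeukolskySlabLawOn (lam * M) (lam * a) (lam * r₀) k w (lam * R) (K * Λ) :=
  -- LANDED p122941 (stub-worker, wave 1 of lead c6): Theorems/PhaseMixingCaptureBulkKerrCaptureC2SlabLawDilate.lean
  Theorems.BulkKerrCaptureC2.SlabLawDilate.stub_slabLaw_dilate

/-! ### §1c (skeleton v3) Glue for the reshape of `L` (PROVED) -/

/-- The slab law is antitone in the locality radius `R` (the local energy is monotone in the ball,
`Kerr.teukolskyEnergyOn_mono`). [folklore] -/
theorem slabLaw_anti_radius [Kerr.Facts] {M a r₀ : ℝ} {k : ℕ} {w R R' Λ : ℝ}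
    (h : Kerr.TeukolskySlabLawOn M a r₀ k w R' Λ) (hR : R ≤ R') : Kerr.TeukolskySlabLawOn M a r₀ k w R Λ := by
  intro _ s hs τ₀ τ₁ hτ α F hαF
  have hsub : Metric.closedBall (0 : E3) R ⊆ Metric.closedBall 0 R' :=
    Metric.closedBall_subset_closedBall hR
  exact le_trans (add_le_add (Kerr.teukolskyEnergyOn_mono M a r₀ s α τ₁ 1 0 hsub)
    (MeasureTheory.lintegral_mono fun τ ↦ Kerr.teukolskyEnergyOn_mono M a r₀ s α τ 1 0 hsub))
    (h s hs τ₀ τ₁ hτ α F hαF)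

/-- `D2` from its registered (hypothesis-carrying) stub and `D1`, `D0`. [folklore] -/
theorem slabPairDilate_of_stubs (h0 : SlabPairContDiff) (h1 : TeukolskyOpDilate)
    (h2 : TeukolskyOpDilate → SlabPairContDiff → SlabPairDilate) : SlabPairDilate :=
  h2 h1 h0

/-- `D4` from its registered (hypothesis-carrying) stub and `D2`, `D3`. [folklore] -/
theorem slabLawDilate_of_stubs (h2 : SlabPairDilate) (h3 : TeukolskyEnergyDilate)
    (h4 : SlabPairDilate → TeukolskyEnergyDilate → SlabLawDilate) : SlabLawDilate :=
  h4 h2 h3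

/-- **`L ⇐ L₁ ∧ D4`** — the reshape proper: dilate the unit-mass law to mass `M ∈ [M₀/2, 2M₀]` (`λ := M`,
spin `a/M`, radius `R₁ := 2|R|/M₀`, constant `K(k, w, M₀/2, 2M₀) · C₁`), then shrink the ball from `M R₁ ≥ R`
to `R` (`slabLaw_anti_radius`). [folklore] -/
theorem bulkTeukolskySlabLaw_of_unitMass (hL₁ : UnitMassSlabLaw) (hD : SlabLawDilate) :
    BulkTeukolskySlabLaw := by
  intro _ a₁ ha₁
  obtain ⟨k, w, hkw⟩ := hL₁ a₁ ha₁
  refine ⟨k, w, fun M₀ hM₀ R ↦ ?_⟩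
  obtain ⟨C₁, hC₁, hlaw₁⟩ := hkw (2 * |R| / M₀)
  obtain ⟨K, hK, hdil⟩ := hD k w (M₀ / 2) (2 * M₀) (by positivity) (by linarith)
  refine ⟨K * C₁, one_le_mul_of_one_le_of_one_le hK hC₁, fun M hlo hhi a ha ↦ ?_⟩
  have hM : 0 < M := by linarith
  have ha' : |a / M| ≤ a₁ := by
    rw [abs_div, abs_of_pos hM, div_le_iff₀ hM]
    exact ha
  have h₂ : Kerr.TeukolskySlabLawOn (M * 1) (M * (a / M)) (M * 1) k w (M * (2 * |R| / M₀)) (K * C₁) :=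
    hdil M hlo hhi 1 (a / M) 1 (2 * |R| / M₀) C₁ (by linarith) (hlaw₁ (a / M) ha')
  have e₁ : M * (a / M) = a := by field_simp
  -- transport along the parameter identities `M * 1 = M`, `M * (a / M) = a` (no `rw` under the instance binder)
  have key : ∀ M' a' r' : ℝ, M' = M → a' = a → r' = M →
      Kerr.TeukolskySlabLawOn M' a' r' k w (M * (2 * |R| / M₀)) (K * C₁) →
      Kerr.TeukolskySlabLawOn M a M k w (M * (2 * |R| / M₀)) (K * C₁) := by
    rintro _ _ _ rfl rfl rfl h
    exact h
  have h₃ : Kerr.TeukolskySlabLawOn M a M k w (M * (2 * |R| / M₀)) (K * C₁) :=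
    key (M * 1) (M * (a / M)) (M * 1) (mul_one M) e₁ (mul_one M) h₂
  have hR : R ≤ M * (2 * |R| / M₀) :=
    calc R ≤ |R| := le_abs_self R
      _ = M₀ / 2 * (2 * |R| / M₀) := by field_simp
      _ ≤ M * (2 * |R| / M₀) := mul_le_mul_of_nonneg_right hlo (by positivity)
  have h₄ : Kerr.TeukolskySlabLawOn M a M k w R (K * C₁) := slabLaw_anti_radius h₃ hR
  -- `assumption`, not `exact h₄`: the def's leading instance binder `[(Kerr.metric …).HasLeviCivita]`
  -- makes `exact` auto-insert an instance argument it cannot synthesise.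
  assumption

/-- **`L` as a theorem of the registered stubs** (`L₁`, `D0`–`D4`; skeleton v3). [folklore] -/
theorem bulkTeukolskySlabLaw_of_stubs (hL₁ : UnitMassSlabLaw) (h0 : SlabPairContDiff)
    (h1 : TeukolskyOpDilate) (h2 : TeukolskyOpDilate → SlabPairContDiff → SlabPairDilate)
    (h3 : TeukolskyEnergyDilate) (h4 : SlabPairDilate → TeukolskyEnergyDilate → SlabLawDilate) :
    BulkTeukolskySlabLaw :=
  bulkTeukolskySlabLaw_of_unitMass hL₁
    (slabLawDilate_of_stubs (slabPairDilate_of_stubs h0 h1 h2) h3 h4)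

/-- `L` wired to the registered stubs (depends on `sorryAx` exactly through `L₁`, `D0`–`D4`). -/
theorem stub_bulkTeukolskySlabLaw_derived : BulkTeukolskySlabLaw :=
  bulkTeukolskySlabLaw_of_stubs stub_unitMassSlabLaw stub_slabPair_contDiffAt stub_teukolskyOpOn_dilate
    stub_slabPair_dilate stub_teukolskyEnergyOn_dilate stub_slabLaw_dilate

/-- **STUB `P∃` (XL, OPEN, HARDEST — the nonlinear debt; skeleton v5 reshape of `P`)** — `PacketClosingBoxExists`,
expanded (`ShellsAt`, `BackgroundBoundAt` unfolded; conclusion = ONE good vacuum Cauchy development per datum in the ball,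
the printed ∃-shape; `P` follows by the landed ascent p125190, `packetClosingBoxC2_of_exists`). Why plausibly true: it is the Einstein-vacuum instance, at bounded
κ, of the printed quasilinear scalar theorem DHRT arXiv:2410.03639 Thm 5.1 + Rem 5.0.3 (same quantifier
shape: one basin on `[−a₀, a₀]`, no control as `a₀ → M`), by the method its authors announce for exactly this
purpose (p. 5 ll.17–27, "This will appear elsewhere"): `(t*, φ*)`-packets (elementary commutators, p. 4),
superradiant packets untrapped (`0 < ω/(am) < 1/(2Mr₊)`, tree `Kerr.sepPotential₀_caseB_of_superradiant`),
each non-superradiant packet trapped inside ONE shell with a timelike Killing field (stub `S`; trapped radii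
`≥ r₊ + c₁M`, per spin `Kerr.exists_sepPotential_trapping_structure`), top-order currents in physical space on
the dynamical metric, the linear law (stub `L`) as inhomogeneous black box below top order; the geometric
scheme (gauge, GCM / teleology, `r^p`, red-shift with `κ ≥ κ(a₂) > 0`, modulation) is the DHRT21
arXiv:2104.08222 / KS–GKS architecture (Klainerman–Szeftel 2023 Thm 1.2.1 + arXiv:2205.14808, refereed for
`|a| ≪ m`; their only small-`a` uses are the E–M estimates, Ma–Szeftel arXiv:2603.23437 Rem 1.4). Why it might
fail: (P.iii) top-order coupling of the Teukolsky pair to the transport / elliptic / gauge quantities and the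
modulation of `(M', a')` have no printed packet-wise treatment at `|a| ≍ M` (DHRT21 is Schwarzschild); the
`C√dist` modulus and the finite-order ball are printed nowhere beyond `|a| ≪ M` (the pre-ruling lines' G1/Mod
residues — here to be PROVED, not ported); size = an unwritten DHRT21-sized paper. NORMAL FORM: modulo `S`,
`L`, `BackgroundUniform` (all true) this stub is EQUIVALENT to `StrongCaptureTwo`
(`packetClosingBoxC2_iff_strong`, §2) — stronger than the crux. [cite: DafermosHolzegelRodnianskiTaylor2024, Thm 5.1] -/
theorem stub_packetClosingBoxExists :
    ∀ [Kerr.Facts] [Kerr.SliceFacts], ∀ (k : ℕ) (w : ℝ), ∀ a₁ : ℝ, a₁ < 1 → ∃ (s : ℕ) (δ : ℝ),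
      ∀ (M : ℝ) (hM : 0 < M), ∃ (R : ℝ) (n : ℕ) (c₁ : ℝ), 0 < c₁ ∧
        ∀ d μ Λ B : ℝ, 0 < d → 0 < μ → 1 ≤ Λ → 1 ≤ B →
          ∃ ε > (0 : ℝ), ∃ C : ℝ, ∀ a : ℝ, |a| ≤ a₁ * M →
            (∀ r₀ : ℝ, Kerr.rPlus M a + c₁ * M ≤ r₀ → r₀ ≤ R * M →
              ∀ x : E4, |Kerr.radius a x - r₀| ≤ d * M →
                Kerr.bilin M a x
                    (E4.basisVector 0 + Kerr.drsrAngularVelocity M a r₀ • Kerr.axialVector x)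
                    (E4.basisVector 0 + Kerr.drsrAngularVelocity M a r₀ • Kerr.axialVector x) ≤ -μ) →
            (∀ M' a' : ℝ, |M' - M| + |a' - a| ≤ M * (1 - (a / M) ^ 2) / 8 →
                Kerr.TeukolskySlabLawOn M' a' M' k w R Λ) →
            (∀ x : E4, x 0 = 0 → M ≤ Kerr.radius a x → Kerr.radius a x ≤ R → ∀ j : ℕ, j ≤ n →
              ‖iteratedFDeriv ℝ j (fun q : ℝ × E4 ↦ Kerr.scalarH M q.1 q.2) (a, x)‖ ≤ B ∧
                ∀ μ : Fin 4,
                  ‖iteratedFDeriv ℝ j (fun q : ℝ × E4 ↦ Kerr.nullCovectorFun q.1 q.2 μ) (a, x)‖ ≤ B) →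
            ∀ (D : InitialDataSet 𝓘(ℝ, E3) (Kerr.slice a M)) [D.metric.HasLeviCivita],
              D.IsVacuumConstraintSolution →
              InitialDataSet.dataWeightedSobolevEDist s δ D (Kerr.data M a M hM.le) < ENNReal.ofReal ε →
              ∃ (𝒟₀ : VacuumCauchyDevelopment D) (M' a' : ℝ) (𝒟oc : Set 𝒟₀.carrier),
                Kerr.IsSubextremal M' a' ∧ 𝒟₀.HasCompleteFutureNullInfinityFar ∧
                𝒟₀.toSpacetime.ConvergesToKerr 𝒟oc M' a' 2 ∧
                |M' - M| + |a' - a| ≤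
                  C * √(InitialDataSet.dataWeightedSobolevEDist s δ D (Kerr.data M a M hM.le)).toReal := by
  sorry

/-- `P∃ ⇒ P`: the capture conclusion ascends from ONE good development to every maximal one (landed
`Theorems.BulkKerrCaptureC2.CaptureAscent.stub_captureAt_of_forall_exists`, p125190). [folklore] -/
theorem packetClosingBoxC2_of_exists (h : PacketClosingBoxExists) : PacketClosingBoxC2 := by
  intro _ _ k w a₁ ha₁
  obtain ⟨s, δ, hsδ⟩ := h k w a₁ ha₁
  refine ⟨s, δ, fun M hM ↦ ?_⟩
  obtain ⟨R, n, c₁, hc₁, hbox⟩ := hsδ M hM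
  refine ⟨R, n, c₁, hc₁, fun d μ Λ B hd hμ hΛ hB ↦ ?_⟩
  obtain ⟨ε, hε, C, hC⟩ := hbox d μ Λ B hd hμ hΛ hB
  exact ⟨ε, hε, C, fun a ha hS hL hB' ↦
    Theorems.BulkKerrCaptureC2.CaptureAscent.stub_captureAt_of_forall_exists s δ 2 M hM.le ε C a
      (hC a ha hS hL hB')⟩

/-- **Former STUB `P` — since skeleton v5 a DERIVED theorem (from the registered `P∃` by `packetClosingBoxC2_of_exists`);
statement kept verbatim for the record** (`PacketClosingBoxC2` expanded: `ShellsAt`, `BackgroundBoundAt`, `CaptureAt`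
unfolded). [cite: DafermosHolzegelRodnianskiTaylor2024, Thm 5.1] -/
theorem stub_packetClosingBoxC2 :
    ∀ [Kerr.Facts] [Kerr.SliceFacts], ∀ (k : ℕ) (w : ℝ), ∀ a₁ : ℝ, a₁ < 1 → ∃ (s : ℕ) (δ : ℝ),
      ∀ (M : ℝ) (hM : 0 < M), ∃ (R : ℝ) (n : ℕ) (c₁ : ℝ), 0 < c₁ ∧
        ∀ d μ Λ B : ℝ, 0 < d → 0 < μ → 1 ≤ Λ → 1 ≤ B →
          ∃ ε > (0 : ℝ), ∃ C : ℝ, ∀ a : ℝ, |a| ≤ a₁ * M →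
            (∀ r₀ : ℝ, Kerr.rPlus M a + c₁ * M ≤ r₀ → r₀ ≤ R * M →
              ∀ x : E4, |Kerr.radius a x - r₀| ≤ d * M →
                Kerr.bilin M a x
                    (E4.basisVector 0 + Kerr.drsrAngularVelocity M a r₀ • Kerr.axialVector x)
                    (E4.basisVector 0 + Kerr.drsrAngularVelocity M a r₀ • Kerr.axialVector x) ≤ -μ) →
            (∀ M' a' : ℝ, |M' - M| + |a' - a| ≤ M * (1 - (a / M) ^ 2) / 8 →
                Kerr.TeukolskySlabLawOn M' a' M' k w R Λ) →
            (∀ x : E4, x 0 = 0 → M ≤ Kerr.radius a x → Kerr.radius a x ≤ R → ∀ j : ℕ, j ≤ n →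
              ‖iteratedFDeriv ℝ j (fun q : ℝ × E4 ↦ Kerr.scalarH M q.1 q.2) (a, x)‖ ≤ B ∧
                ∀ μ : Fin 4,
                  ‖iteratedFDeriv ℝ j (fun q : ℝ × E4 ↦ Kerr.nullCovectorFun q.1 q.2 μ) (a, x)‖ ≤ B) →
            ∀ (D : InitialDataSet 𝓘(ℝ, E3) (Kerr.slice a M)) [D.metric.HasLeviCivita],
              D.IsVacuumConstraintSolution →
              InitialDataSet.dataWeightedSobolevEDist s δ D (Kerr.data M a M hM.le) < ENNReal.ofReal ε →
              ∀ 𝒟 : VacuumCauchyDevelopment D, 𝒟.IsMaximal →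
                ∃ (M' a' : ℝ) (𝒟oc : Set 𝒟.carrier), Kerr.IsSubextremal M' a' ∧
                  𝒟.HasCompleteFutureNullInfinityFar ∧
                  𝒟.toSpacetime.ConvergesToKerr 𝒟oc M' a' 2 ∧
                  |M' - M| + |a' - a| ≤
                    C * √(InitialDataSet.dataWeightedSobolevEDist s δ D (Kerr.data M a M hM.le)).toReal :=
  -- since skeleton v5: DERIVED from the registered stub `P∃` (no `sorry` of its own)
  packetClosingBoxC2_of_exists stub_packetClosingBoxExists

/-! ### Consistency: each named statement IS its registered stub (definitionally) -/

theorem uniformKillingShells_holds : UniformKillingShells := stub_uniformKillingShells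
theorem unitMassSlabLaw_holds : UnitMassSlabLaw := stub_unitMassSlabLaw
theorem slabPairContDiff_holds : SlabPairContDiff := stub_slabPair_contDiffAt
theorem teukolskyOpDilate_holds : TeukolskyOpDilate := stub_teukolskyOpOn_dilate
theorem slabPairDilate_holds : SlabPairDilate :=
  slabPairDilate_of_stubs stub_slabPair_contDiffAt stub_teukolskyOpOn_dilate stub_slabPair_dilate
theorem teukolskyEnergyDilate_holds : TeukolskyEnergyDilate := stub_teukolskyEnergyOn_dilate
theorem slabLawDilate_holds : SlabLawDilate :=
  slabLawDilate_of_stubs slabPairDilate_holds stub_teukolskyEnergyOn_dilate stub_slabLaw_dilate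
theorem bulkTeukolskySlabLaw_holds : BulkTeukolskySlabLaw := stub_bulkTeukolskySlabLaw_derived
theorem packetClosingBoxC2_holds : PacketClosingBoxC2 := stub_packetClosingBoxC2
theorem packetClosingBoxExists_holds : PacketClosingBoxExists := stub_packetClosingBoxExists

/-! ### Name-keyed aliases of the open statements (hypotheses of the composition) -/
namespace Registered

/-- Alias of `UniformKillingShells` keyed by the (now CLOSED, p117565) stub name — kept for the record; no
longer a hypothesis of the composition. -/
abbrev stub_uniformKillingShells : Prop := UniformKillingShells
/-- Alias of `BulkTeukolskySlabLaw` keyed by the RETIRED stub name (skeleton v2; now a theorem of the stubs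
below) — kept for the record; no longer a hypothesis of the composition. -/
abbrev stub_bulkTeukolskySlabLaw : Prop := BulkTeukolskySlabLaw
/-- Alias of `UnitMassSlabLaw` keyed by the registered stub name (`L₁`). -/
abbrev stub_unitMassSlabLaw : Prop := UnitMassSlabLaw
/-- Alias of `SlabPairContDiff` keyed by the registered stub name (`D0`). -/
abbrev stub_slabPair_contDiffAt : Prop := SlabPairContDiff
/-- Alias of `TeukolskyOpDilate` keyed by the registered stub name (`D1`). -/
abbrev stub_teukolskyOpOn_dilate : Prop := TeukolskyOpDilate
/-- Alias of the hypothesis-carrying statement of the registered stub `D2`. -/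
abbrev stub_slabPair_dilate : Prop := TeukolskyOpDilate → SlabPairContDiff → SlabPairDilate
/-- Alias of `TeukolskyEnergyDilate` keyed by the registered stub name (`D3`). -/
abbrev stub_teukolskyEnergyOn_dilate : Prop := TeukolskyEnergyDilate
/-- Alias of the hypothesis-carrying statement of the registered stub `D4`. -/
abbrev stub_slabLaw_dilate : Prop := SlabPairDilate → TeukolskyEnergyDilate → SlabLawDilate
/-- Alias of `PacketClosingBoxC2` keyed by the RETIRED stub name (skeleton v4; since v5 a theorem derived from `P∃`). -/
abbrev stub_packetClosingBoxC2 : Prop := PacketClosingBoxC2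
/-- Alias of `PacketClosingBoxExists` keyed by the registered stub name (`P∃`, skeleton v5). -/
abbrev stub_packetClosingBoxExists : Prop := PacketClosingBoxExists

end Registered

/-! ## §2 Glue (PROVED): monotonicity, the parameter box, shell centres, the normal form -/

/-- `CaptureAt` is antitone in the basin and monotone in the modulus constant. [folklore] -/
theorem captureAt_mono' [Kerr.Facts] [Kerr.SliceFacts] {s : ℕ} {δ : ℝ} {k : ℕ} {M : ℝ}
    {hM : 0 ≤ M} {a ε ε' C C' : ℝ} (h : CaptureAt s δ k M hM ε C a) (hε : ε' ≤ ε) (hC : C ≤ C') :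
    CaptureAt s δ k M hM ε' C' a := by
  intro D _ hvac hdist 𝒟 hmax
  obtain ⟨M', a', 𝒟oc, hsub, hfar, hconv, hmod⟩ :=
    h D hvac (hdist.trans_le (ENNReal.ofReal_le_ofReal hε)) 𝒟 hmax
  exact ⟨M', a', 𝒟oc, hsub, hfar, hconv,
    hmod.trans (mul_le_mul_of_nonneg_right hC (Real.sqrt_nonneg _))⟩

/-- **The parameter box stays in a compact sub-extremal spin set.** If `0 < M`, `0 ≤ a₁ < 1`, `|a| ≤ a₁M`
and `|M' − M| + |a' − a| ≤ M(1 − (a/M)²)/8` then `M/2 ≤ M' ≤ 2M` and `|a'| ≤ √((2 + a₁²)/3)·M'` (from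
`χ' ≥ χ/3`; adapted from `box_bounds` of `Cruxes/NearExtremalKappaCapture/Lines/polynomial_closure.lean`).
This is where `a₁ < 1` makes the ENLARGED threshold `a₂ := √((2 + a₁²)/3)` still `< 1`. [folklore] -/
theorem box_threshold {M a M' a' a₁ : ℝ} (hM : 0 < M) (ha₁ : 0 ≤ a₁) (ha₁' : a₁ < 1)
    (ha : |a| ≤ a₁ * M) (hbox : |M' - M| + |a' - a| ≤ M * (1 - (a / M) ^ 2) / 8) :
    M / 2 ≤ M' ∧ M' ≤ 2 * M ∧ |a'| ≤ √((2 + a₁ ^ 2) / 3) * M' := by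
  -- adapted from `box_bounds` of Cruxes/NearExtremalKappaCapture/Lines/polynomial_closure.lean
  have haM : |a| < M := lt_of_le_of_lt ha (by nlinarith)
  set u : ℝ := M - |a| with hu
  have hu0 : 0 < u := by rw [hu]; linarith
  have hchi : M * (1 - (a / M) ^ 2) = u * ((M + |a|) / M) := by
    rw [hu, div_pow, ← sq_abs a]; field_simp; ring
  have hchi2 : M * (1 - (a / M) ^ 2) ≤ 2 * u := by
    rw [hchi]
    have : (M + |a|) / M ≤ 2 := by rw [div_le_iff₀ hM]; linarith
    exact (mul_le_mul_of_nonneg_left this hu0.le).trans_eq (by ring)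
  have hd : |M' - M| + |a' - a| ≤ u / 4 := by linarith
  have hM'lo : M - u / 4 ≤ M' := by linarith [neg_abs_le (M' - M), abs_nonneg (a' - a)]
  have hM'hi : M' ≤ M + u / 4 := by linarith [le_abs_self (M' - M), abs_nonneg (a' - a)]
  have huM : u ≤ M := by rw [hu]; linarith [abs_nonneg a]
  have hM'pos : 0 < M' := by linarith
  have ht : (a / M) ^ 2 ≤ a₁ ^ 2 := by
    rw [div_pow, div_le_iff₀ (by positivity), ← sq_abs a]
    have : |a| ^ 2 ≤ (a₁ * M) ^ 2 := pow_le_pow_left₀ (abs_nonneg a) ha 2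
    nlinarith
  have hχ0 : 0 ≤ 1 - (a / M) ^ 2 := by nlinarith
  have hM'le : M' ≤ 9 / 8 * M := by
    have e1 : M * (1 - (a / M) ^ 2) / 8 ≤ M / 8 := by nlinarith [sq_nonneg (a / M)]
    have e2 : |M' - M| ≤ M / 8 := by linarith [abs_nonneg (a' - a)]
    linarith [le_abs_self (M' - M)]
  have hgap : 3 * u / 4 ≤ M' - |a'| := by
    have e1 : |a'| ≤ |a| + |a' - a| := by
      calc |a'| = |a + (a' - a)| := by ring_nf
        _ ≤ |a| + |a' - a| := abs_add_le _ _
    have e2 := neg_abs_le (M' - M)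
    rw [hu]
    linarith
  refine ⟨by linarith, by linarith, ?_⟩
  have hchi' : (M' - |a'|) / M' ≤ 1 - (a' / M') ^ 2 := by
    rw [div_pow, ← sq_abs a', div_le_iff₀ hM'pos]
    have ha'0 : 0 ≤ |a'| := abs_nonneg a'
    have hlt : |a'| < M' := by linarith
    have e : (1 - |a'| ^ 2 / M' ^ 2) * M' = (M' - |a'|) * ((M' + |a'|) / M') := by
      field_simp; ring
    rw [e]
    have : 1 ≤ (M' + |a'|) / M' := by rw [le_div_iff₀ hM'pos]; linarith
    exact le_mul_of_one_le_right (by linarith) this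
  have hstep : (1 - (a / M) ^ 2) / 3 ≤ (M' - |a'|) / M' := by
    rw [div_le_div_iff₀ (by norm_num : (0:ℝ) < 3) hM'pos]
    have e0 : (1 - (a / M) ^ 2) * M ≤ 2 * u := by linarith [hchi2]
    have e1 : (1 - (a / M) ^ 2) * M' ≤ (1 - (a / M) ^ 2) * (9 / 8 * M) :=
      mul_le_mul_of_nonneg_left hM'le hχ0
    linarith
  have hsq : (a' / M') ^ 2 ≤ (2 + a₁ ^ 2) / 3 := by linarith [hstep.trans hchi']
  have habs : |a' / M'| ≤ √((2 + a₁ ^ 2) / 3) := by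
    rw [← Real.sqrt_sq_eq_abs]
    exact Real.sqrt_le_sqrt hsq
  rw [abs_div, abs_of_pos hM'pos, div_le_iff₀ hM'pos] at habs
  exact habs

/-- **Shell centres are timelike (the `d = 0` case of `ShellsAt`) — DRSR Lemma 4.7.1 from the tree.** At a
point of radius EXACTLY `r₀ > r₊` the frozen field `T + ω(r₀)Φ` is the DRSR field, hence timelike
(`Kerr.bilin_drsrVector_neg`); certifies the sign convention (`≤ −μ` = timelike) and non-vacuity of stub `S` at
the centres. [cite: DafermosRodnianskiShlapentokhrothman2014, Lemma 4.7.1] -/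
theorem shellCentre_timelike {M a r₀ : ℝ} (hMa : Kerr.IsSubextremal M a) {x : E4}
    (hx : Kerr.radius a x = r₀) (hr : Kerr.rPlus M a < r₀) :
    Kerr.bilin M a x (killingComb (Kerr.drsrAngularVelocity M a r₀) x)
        (killingComb (Kerr.drsrAngularVelocity M a r₀) x) < 0 := by
  have h := Kerr.bilin_drsrVector_neg hMa (x := x) (by rw [hx]; exact hr)
  simpa only [killingComb, Kerr.drsrVector, hx] using h

/-- In particular at every admissible centre of stub `S` (`M > 0`, `|a| < M`, `c₁ > 0`, `r₀ ≥ r₊ + c₁M`) the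
field is strictly timelike — `S` forces nothing false at `d = 0`. [folklore] -/
example {M a c₁ r₀ : ℝ} (hM : 0 < M) (hMa : Kerr.IsSubextremal M a) (hc₁ : 0 < c₁)
    (hr₀ : Kerr.rPlus M a + c₁ * M ≤ r₀) {x : E4} (hx : Kerr.radius a x = r₀) :
    Kerr.bilin M a x (killingComb (Kerr.drsrAngularVelocity M a r₀) x)
        (killingComb (Kerr.drsrAngularVelocity M a r₀) x) < 0 :=
  shellCentre_timelike hMa hx (lt_of_lt_of_le (by nlinarith) hr₀)

/-- `S ∧ P ⇒ T` (read `(d, μ)` off `UniformKillingShells` at `(a₁, c₁, R)`). [folklore] -/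
theorem bulkClosingBoxC2_of_packets (hS : UniformKillingShells) (hP : PacketClosingBoxC2) :
    BulkClosingBoxC2 := by
  intro _ _ k w a₁ ha₁
  obtain ⟨s, δ, hsδ⟩ := hP k w a₁ ha₁
  refine ⟨s, δ, fun M hM ↦ ?_⟩
  obtain ⟨R, n, c₁, hc₁, hbox⟩ := hsδ M hM
  obtain ⟨d, hd, μ, hμ, hshell⟩ := hS a₁ ha₁ c₁ R hc₁
  refine ⟨R, n, fun Λ B hΛ hB ↦ ?_⟩
  obtain ⟨ε, hε, C, hC⟩ := hbox d μ Λ B hd hμ hΛ hB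
  exact ⟨ε, hε, C, fun a ha hlaw hbg ↦ hC a ha (hshell M hM a ha) hlaw hbg⟩

/-- **`L ∧ BackgroundUniform ∧ T ⇒ StrongCaptureTwo`** — the composition proper: the law is consumed on the
parameter boxes, i.e. up to the enlarged threshold `a₂ = √((2 + a₁²)/3) < 1` (`box_threshold`), the background
bound at every `|a| ≤ M`; the `a₁ < 0` branch is vacuous (`Negative.no_spin_of_neg`, Disproof §2).
[folklore] -/
theorem strongCaptureTwo_of_bulkClosingBox (hL : BulkTeukolskySlabLaw) (hβ : BackgroundUniform)
    (hT : BulkClosingBoxC2) : StrongCaptureTwo := by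
  intro _ _ a₁ ha₁
  rcases lt_or_ge a₁ 0 with hneg | h0
  · exact ⟨0, 0, fun M hM ↦ ⟨1, one_pos, 0, fun a ha ↦ (no_spin_of_neg hneg hM ha).elim⟩⟩
  · set a₂ : ℝ := √((2 + a₁ ^ 2) / 3) with ha₂
    have ha₂lt : a₂ < 1 := by
      rw [ha₂, Real.sqrt_lt' one_pos]
      nlinarith
    obtain ⟨k, w, hlaw⟩ := hL a₂ ha₂lt
    obtain ⟨s, δ, hsδ⟩ := hT k w a₁ ha₁
    refine ⟨s, δ, fun M hM ↦ ?_⟩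
    obtain ⟨R, n, hRn⟩ := hsδ M hM
    obtain ⟨CL, hCL1, hCL⟩ := hlaw M hM R
    obtain ⟨B, hB1, hB⟩ := hβ M hM n R
    obtain ⟨ε, hε, C, hC⟩ := hRn CL B hCL1 hB1
    refine ⟨ε, hε, C, fun a ha ↦ hC a ha ?_ ?_⟩
    · intro M' a' hbox
      obtain ⟨hlo, hhi, ha'⟩ := box_threshold hM h0 ha₁ ha hbox
      exact hCL M' hlo hhi a' ha'
    · exact hB a (ha.trans (by nlinarith))

/-- `StrongCaptureTwo ⇒ T` (drop the two hypotheses). [folklore] -/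
theorem bulkClosingBoxC2_of_strong (h : StrongCaptureTwo) : BulkClosingBoxC2 := by
  intro _ _ k w a₁ ha₁
  obtain ⟨s, δ, hsδ⟩ := h a₁ ha₁
  refine ⟨s, δ, fun M hM ↦ ⟨0, 0, fun Λ B _ _ ↦ ?_⟩⟩
  obtain ⟨ε, hε, C, hC⟩ := hsδ M hM
  exact ⟨ε, hε, C, fun a ha _ _ ↦ hC a ha⟩

/-- `StrongCaptureTwo ⇒ P` (drop the three hypotheses). [folklore] -/
theorem packetClosingBoxC2_of_strong (h : StrongCaptureTwo) : PacketClosingBoxC2 := by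
  intro _ _ k w a₁ ha₁
  obtain ⟨s, δ, hsδ⟩ := h a₁ ha₁
  refine ⟨s, δ, fun M hM ↦ ⟨0, 0, 1, one_pos, fun d μ Λ B _ _ _ _ ↦ ?_⟩⟩
  obtain ⟨ε, hε, C, hC⟩ := hsδ M hM
  exact ⟨ε, hε, C, fun a ha _ _ _ ↦ hC a ha⟩

/-- **NORMAL FORM OF THE DEBT (i)**: granted the linear law, `T ⇔ StrongCaptureTwo` (r2-2's
`bulkClosingBoxC2_iff_strong`, re-derived; `BackgroundUniform` discharged by p77983). [folklore] -/
theorem bulkClosingBoxC2_iff_strong (hL : BulkTeukolskySlabLaw) :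
    BulkClosingBoxC2 ↔ StrongCaptureTwo :=
  ⟨strongCaptureTwo_of_bulkClosingBox hL backgroundUniform_holds, bulkClosingBoxC2_of_strong⟩

/-- **NORMAL FORM OF THE DEBT (ii)**: granted the shells and the linear law, the hardest stub
`P ⇔ StrongCaptureTwo` — the pre-ruling strong form at `k = 2`, STRONGER than the crux (r2-2's
`packetClosingBoxC2_iff_strong`, re-derived). No later seat may read this line as weaker than the pre-ruling
rank 4. [folklore] -/
theorem packetClosingBoxC2_iff_strong (hS : UniformKillingShells) (hL : BulkTeukolskySlabLaw) :
    PacketClosingBoxC2 ↔ StrongCaptureTwo :=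
  ⟨fun hP ↦ strongCaptureTwo_of_bulkClosingBox hL backgroundUniform_holds
      (bulkClosingBoxC2_of_packets hS hP),
    packetClosingBoxC2_of_strong⟩

/-- **NORMAL FORM OF THE DEBT (iii), after `S` landed (p117565)**: granted ONLY the linear law, the hardest stub
`P ⇔ StrongCaptureTwo`. With `S` a theorem, the line's open content is exactly {`L`, `StrongCaptureTwo`}: the
printed-per-spin linear slab law and the pre-ruling strong-form bulk capture at order two (≥ the crux). [folklore] -/
theorem packetClosingBoxC2_iff_strong' (hL : BulkTeukolskySlabLaw) :
    PacketClosingBoxC2 ↔ StrongCaptureTwo :=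
  packetClosingBoxC2_iff_strong uniformKillingShells_holds hL

/-- **NORMAL FORM OF THE DEBT (iv), after `D0`–`D4` landed (skeleton v4)**: granted ONLY the unit-mass law `L₁`, the
hardest stub `P ⇔ StrongCaptureTwo`. The line's open content is exactly {`L₁`, `StrongCaptureTwo`}: the unprinted a-uniform
inhomogeneous `s = ±2` slab law at unit mass, and the pre-ruling strong-form bulk capture at order two (≥ the crux). [folklore] -/
theorem packetClosingBoxC2_iff_strong'' (hL₁ : UnitMassSlabLaw) :
    PacketClosingBoxC2 ↔ StrongCaptureTwo :=
  packetClosingBoxC2_iff_strong'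
    (bulkTeukolskySlabLaw_of_stubs hL₁ slabPairContDiff_holds teukolskyOpDilate_holds stub_slabPair_dilate
      teukolskyEnergyDilate_holds stub_slabLaw_dilate)

/-- `P ⇒ P∃` modulo EXISTENCE of maximal developments of the vacuum data on the Kerr slices (Choquet-Bruhat–Geroch,
CMP 14 (1969), Thm 3 — taken as a hypothesis `hMGHD`, no named fact consumed): the MGHD itself is the good development
(`Theorems.BulkKerrCaptureC2.CaptureAscent.forall_exists_of_captureAt`). [folklore] -/
theorem packetClosingBoxExists_of_packetClosingBoxC2
    (hMGHD : ∀ [Kerr.Facts] [Kerr.SliceFacts] (a M : ℝ) (D : InitialDataSet 𝓘(ℝ, E3) (Kerr.slice a M))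
      [D.metric.HasLeviCivita], D.IsVacuumConstraintSolution → ∃ 𝒟 : VacuumCauchyDevelopment D, 𝒟.IsMaximal)
    (h : PacketClosingBoxC2) : PacketClosingBoxExists := by
  intro _ _ k w a₁ ha₁
  obtain ⟨s, δ, hsδ⟩ := h k w a₁ ha₁
  refine ⟨s, δ, fun M hM ↦ ?_⟩
  obtain ⟨R, n, c₁, hc₁, hbox⟩ := hsδ M hM
  refine ⟨R, n, c₁, hc₁, fun d μ Λ B hd hμ hΛ hB ↦ ?_⟩
  obtain ⟨ε, hε, C, hC⟩ := hbox d μ Λ B hd hμ hΛ hB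
  refine ⟨ε, hε, C, fun a ha hS hL hB' ↦ ?_⟩
  exact Theorems.BulkKerrCaptureC2.CaptureAscent.forall_exists_of_captureAt (hC a ha hS hL hB')
    fun D _ hvac _ ↦ hMGHD a M D hvac

/-- **NORMAL FORM OF THE DEBT (v), skeleton v5**: granted ONLY the unit-mass law `L₁`, the registered stub `P∃` implies
`StrongCaptureTwo` (through `P`); conversely `StrongCaptureTwo ⇒ P∃` modulo existence of maximal developments. In substance the
open content is unchanged — {`L₁`, `StrongCaptureTwo` (≥ crux)} — but the stub's prover now owes ONE development per datum,
the printed shape of every stability theorem. [folklore] -/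
theorem strongCaptureTwo_of_packetClosingBoxExists (hL₁ : UnitMassSlabLaw) (h : PacketClosingBoxExists) :
    StrongCaptureTwo :=
  (packetClosingBoxC2_iff_strong'' hL₁).1 (packetClosingBoxC2_of_exists h)

/-- **The line's output also closes the route's SUPPORT item `BulkKerrCapture`** (pre-ruling strong form,
`∃ k`: witness `k := 2`). [folklore] -/
theorem bulkKerrCapture_of_strong (h : StrongCaptureTwo) : BulkKerrCapture := by
  rw [bulkKerrCapture_iff]
  intro _ _ a₁ ha₁
  obtain ⟨s, δ, hsδ⟩ := h a₁ ha₁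
  exact ⟨s, δ, 2, hsδ⟩

/-! ## §3 The composition (concludes the crux BY NAME; no `sorry` of its own) -/

/-- **Composition (skeleton v5).** `S` (shells, LANDED p117565), the dilation covariance `D0`–`D4` (LANDED p120331,
p120876, p121404, p122447, p122941) and the ascent `P∃ ⇒ P` (LANDED p125190) are discharged INSIDE; `L₁` (unit-mass law) + `D`
⇒ `L` (`bulkTeukolskySlabLaw_of_unitMass`); `P∃` ⇒ `P`; `S` + `P` ⇒ `T`; `L` on the boxes (threshold `a₂`) + landed
`BackgroundUniform` + `T` ⇒ `StrongCaptureTwo`; ⇒ the crux by the landed `bulkKerrCaptureC2_of_captureAt_two`. Depends on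
`sorryAx` only through the TWO open registered stubs `L₁`, `P∃` when wired (`example` below). [folklore] -/
theorem BulkKerrCaptureC2_of
    (hL₁ : Registered.stub_unitMassSlabLaw) (hP : Registered.stub_packetClosingBoxExists) :
    BulkKerrCaptureC2 :=
  -- `S`, `D0`–`D4` and the ascent `P∃ ⇒ P` are discharged inside by LANDED files; the remaining hypotheses are exactly `L₁`, `P∃`.
  bulkKerrCaptureC2_of_captureAt_two
    (strongCaptureTwo_of_bulkClosingBox
      (bulkTeukolskySlabLaw_of_stubs hL₁ slabPairContDiff_holds teukolskyOpDilate_holds stub_slabPair_dilate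
        teukolskyEnergyDilate_holds stub_slabLaw_dilate)
      backgroundUniform_holds
      (bulkClosingBoxC2_of_packets uniformKillingShells_holds (packetClosingBoxC2_of_exists hP)))

/-- Wiring: the expanded stub statements are definitionally the named hypotheses. -/
example : BulkKerrCaptureC2 :=
  BulkKerrCaptureC2_of stub_unitMassSlabLaw stub_packetClosingBoxExists

/-- The v4 (pre-reshape) reading of the same composition: `L₁ ∧ P ⇒ crux`. -/
example (hL₁ : UnitMassSlabLaw) (hP : PacketClosingBoxC2) : BulkKerrCaptureC2 :=
  bulkKerrCaptureC2_of_captureAt_two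
    (strongCaptureTwo_of_bulkClosingBox
      (bulkTeukolskySlabLaw_of_stubs hL₁ slabPairContDiff_holds teukolskyOpDilate_holds stub_slabPair_dilate
        teukolskyEnergyDilate_holds stub_slabLaw_dilate)
      backgroundUniform_holds (bulkClosingBoxC2_of_packets uniformKillingShells_holds hP))

/-- The v2 (two-hypothesis) reading of the same composition: `L ∧ P ⇒ crux`. -/
example (hL : BulkTeukolskySlabLaw) (hP : PacketClosingBoxC2) : BulkKerrCaptureC2 :=
  bulkKerrCaptureC2_of_captureAt_two
    (strongCaptureTwo_of_bulkClosingBox hL backgroundUniform_holds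
      (bulkClosingBoxC2_of_packets uniformKillingShells_holds hP))

/-- The card-1 (door-agnostic) reading of the same composition: `L ∧ T ⇒ crux`. -/
example (hL : BulkTeukolskySlabLaw) (hT : BulkClosingBoxC2) : BulkKerrCaptureC2 :=
  bulkKerrCaptureC2_of_captureAt_two (strongCaptureTwo_of_bulkClosingBox hL backgroundUniform_holds hT)

/-- The normal form closes both rank 4 and the pre-ruling support item. -/
example (h : StrongCaptureTwo) : BulkKerrCaptureC2 ∧ BulkKerrCapture :=
  ⟨bulkKerrCaptureC2_of_captureAt_two h, bulkKerrCapture_of_strong h⟩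

/-! ## §4 Cross-route record (NOT part of the line): the rank-2 transfer with its order pinned

`PolynomialClosingBoxC2` is NOT the registered stub 3″ of `Cruxes/NearExtremalKappaCapture/Lines/polynomial_closure.lean`
(that stub has `∃ … (kc : ℕ) …`, l.166 — triage r2-1/2/3); it is its `kc := 2` pin, which the route text asks
the rank-2 leads to adopt ("leads should already state kc := 2", TWO-LAYER PLAN). Recorded so that IF stub 3″
is pinned, `T` (hence, with `L`, rank 4) follows at bounded κ by exponent bookkeeping: on `|a| ≤ a₁M`,
`χ ≥ χ₁ := 1 − a₁² > 0`, so every κ-power is a constant. A ROUTE-TOPOLOGY datum for the tenure planner (option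
(E) of card 1), "useless as a proof order" (r2-3: stub 3″ must hold as `κ → 0`, strictly harder than `T`). -/

/-- `PolynomialClosingBox` of the rank-2 line with `kc := 2` (otherwise verbatim, over this file's `CaptureAt`
form of the far clause). -/
def PolynomialClosingBoxC2 : Prop :=
  ∀ [Kerr.Facts] [Kerr.SliceFacts], ∀ (k : ℕ) (w : ℝ),
    ∃ (s : ℕ) (δ : ℝ) (N : ℕ) (γ₀ : ℝ), ∀ (M : ℝ) (hM : 0 < M),
      ∃ (R : ℝ) (n : ℕ) (c₀ : ℝ), 0 < c₀ ∧ ∃ C₀ : ℝ, 0 ≤ C₀ ∧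
        ∀ a : ℝ, Kerr.IsSubextremal M a → ∀ Λ B : ℝ, 1 ≤ Λ → 1 ≤ B →
          (∀ M' a' : ℝ, |M' - M| + |a' - a| ≤ M * (1 - (a / M) ^ 2) / 8 →
              Kerr.TeukolskySlabLawOn M' a' M' k w R Λ) →
            BackgroundBoundAt M a n R B →
              CaptureAt s δ 2 M hM.le (c₀ * (1 - (a / M) ^ 2) ^ γ₀ * ((Λ * B) ^ N)⁻¹)
                (C₀ * (1 - (a / M) ^ 2) ^ (-γ₀) * (Λ * B) ^ N) a

/-- The κ-tracked transfer at `kc := 2` implies the bulk box (bookkeeping: basin and modulus are bounded by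
their values at `χ₁ := 1 − a₁²` or at `χ = 1`, by the sign of `γ₀`). [folklore] -/
theorem bulkClosingBoxC2_of_polynomial (h : PolynomialClosingBoxC2) : BulkClosingBoxC2 := by
  intro _ _ k w a₁ ha₁
  obtain ⟨s, δ, N, γ₀, hM⟩ := h k w
  refine ⟨s, δ, fun M hMpos ↦ ?_⟩
  obtain ⟨R, n, c₀, hc₀, C₀, hC₀, hbox⟩ := hM M hMpos
  refine ⟨R, n, fun Λ B hΛ hB ↦ ?_⟩
  rcases lt_or_ge a₁ 0 with hneg | h0
  · exact ⟨1, one_pos, 0, fun a ha ↦ (no_spin_of_neg hneg hMpos ha).elim⟩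
  · set χ₁ : ℝ := 1 - a₁ ^ 2 with hχ₁
    have hχ₁0 : 0 < χ₁ := by rw [hχ₁]; nlinarith
    set m : ℝ := min 1 (χ₁ ^ γ₀) with hm
    set m' : ℝ := max 1 (χ₁ ^ (-γ₀)) with hm'
    have hm0 : 0 < m := lt_min one_pos (Real.rpow_pos_of_pos hχ₁0 _)
    have hΛB : 0 < (Λ * B) ^ N := pow_pos (mul_pos (by linarith) (by linarith)) N
    refine ⟨c₀ * m * ((Λ * B) ^ N)⁻¹, by positivity, C₀ * m' * (Λ * B) ^ N,
      fun a ha hlaw hbg ↦ ?_⟩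
    have haM : |a| < M := lt_of_le_of_lt ha (by nlinarith)
    have hsub : Kerr.IsSubextremal M a := haM
    have ht : (a / M) ^ 2 ≤ a₁ ^ 2 := by
      rw [div_pow, div_le_iff₀ (by positivity), ← sq_abs a]
      have : |a| ^ 2 ≤ (a₁ * M) ^ 2 := pow_le_pow_left₀ (abs_nonneg a) ha 2
      nlinarith
    have hχlo : χ₁ ≤ 1 - (a / M) ^ 2 := by rw [hχ₁]; linarith
    have hχhi : 1 - (a / M) ^ 2 ≤ 1 := by nlinarith [sq_nonneg (a / M)]
    have hχ0 : 0 < 1 - (a / M) ^ 2 := hχ₁0.trans_le hχlo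
    have hbasin : m ≤ (1 - (a / M) ^ 2) ^ γ₀ := by
      rcases le_or_gt 0 γ₀ with hγ | hγ
      · exact (min_le_right _ _).trans (Real.rpow_le_rpow hχ₁0.le hχlo hγ)
      · calc m ≤ 1 := min_le_left _ _
          _ = (1 : ℝ) ^ γ₀ := (Real.one_rpow _).symm
          _ ≤ (1 - (a / M) ^ 2) ^ γ₀ := Real.rpow_le_rpow_of_nonpos hχ0 hχhi hγ.le
    have hmod : (1 - (a / M) ^ 2) ^ (-γ₀) ≤ m' := by
      rcases le_or_gt 0 γ₀ with hγ | hγ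
      · exact (Real.rpow_le_rpow_of_nonpos hχ₁0 hχlo (neg_nonpos.2 hγ)).trans (le_max_right _ _)
      · calc (1 - (a / M) ^ 2) ^ (-γ₀) ≤ (1 : ℝ) ^ (-γ₀) :=
              Real.rpow_le_rpow hχ0.le hχhi (by linarith)
          _ = 1 := Real.one_rpow _
          _ ≤ m' := le_max_left _ _
    have hcap := hbox a hsub Λ B hΛ hB hlaw hbg
    refine captureAt_mono' hcap ?_ ?_
    · have : c₀ * m ≤ c₀ * (1 - (a / M) ^ 2) ^ γ₀ := mul_le_mul_of_nonneg_left hbasin hc₀.le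
      exact mul_le_mul_of_nonneg_right this (inv_nonneg.2 hΛB.le)
    · have : C₀ * (1 - (a / M) ^ 2) ^ (-γ₀) ≤ C₀ * m' := mul_le_mul_of_nonneg_left hmod hC₀
      exact mul_le_mul_of_nonneg_right this hΛB.le

/-- Option (E), kernel-checked shape: the pinned rank-2 transfer and the bounded-κ linear law give rank 4
(not a proof ORDER anyone should follow — a redundancy record). -/
example (hL : BulkTeukolskySlabLaw) (h3 : PolynomialClosingBoxC2) : BulkKerrCaptureC2 :=
  bulkKerrCaptureC2_of_captureAt_two
    (strongCaptureTwo_of_bulkClosingBox hL backgroundUniform_holds (bulkClosingBoxC2_of_polynomial h3))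

end Summit.FinalStateConjecture.FinalStateConjecture.Cruxes.BulkKerrCaptureC2.BoundedKappaClosingBox

end
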